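import Literature.Topology.FourManifolds.MorseBirthInsertion
import Literature.Topology.FourManifolds.BoundarySliceCharts
import Literature.Topology.FourManifolds.FlowFibreMorseAlgebra
import HarnessLib

/-!
# The implant model of the (unbalanced) stabilisation of a trisection: calculus on `ℝ⁴`

Topic `Literature/Topology/FourManifolds`; infrastructure for the fact seat
`provefact-Literature.Topology.FourManifolds.exists-14560f9fc8` (named fact (c′)
`Literature.Topology.FourManifolds.exists_stabilized_gkTrisection`, Gay–Kirby 2016, Def. 8 and
Lemma 10).  Everything in this file is **proved**; no definitions, no named facts (the model
functions enter the lemmas through "formula hypotheses" `hnN`, `huN`, `hvN`, `hq`).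

Gay–Kirby prove Lemma 10 (the stabilisation of Def. 8 is again a trisection, of genus `g + 3`)
by adding three "eyes" to a trisected Morse `2`-function; one eye — a birth of a cancelling
pair of critical points in one sector — is the *unbalanced* stabilisation, raising the genus by
one and `k_i` by one.  Over the tree's predicate `IsGKTrisection` the sectors near the central
surface `F` are, in a product chart, the three linear wedges of the normal `(u, v)`-plane
(`TrisectionsNormalCoordinates.lean`, `TrisectionsProductStructure.lean`), and the surgery
replaces `(u, v)` by `(ũ, ṽ) = (u - m, v - m)` inside a small ball.  This file is the calculus
of that replacement on the model `ℝ⁴` with coordinates `x = (n, s, t, p)`, `u = (p - n)/2`,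
`v = (-p - n)/2`, `z = (n, s, t) = dropLast x`:

* `Implant.exists_birth_recentred` — Milnor's birth function `N` on `ℝ³` (Lemma 8.2 for
  `(n, λ) = (3, 1)`, `MorseBirth.exists_birthPair_fine`) recentred along the `n`-axis so that
  its two critical values lie on opposite sides of `0`: `N = n` off a compact subset of a
  prescribed ball, `|N - n| < ε`, `crit N = {z₀, z₁}` of indices `1, 2`, `N z₀ < 0 < N z₁`;
* the modification `m = θ_{P₀}(p) · M(z)/2`, `M = N - n`, `θ_{P₀}` the plateau cutoff of
  `MorseBirthLemma.lean`; `n″ = n + θ_{P₀}(p) M(z)`, `ũ = (p - n″)/2`, `ṽ = (-p - n″)/2`,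
  `q = -ũ ṽ = (p² - n″²)/4`: first derivatives (`hasFDerivAt_nN`, `hasFDerivAt_q`, evaluation
  on the basis, `crit_equations`);
* `Implant.eq_of_fderiv_q_eq_zero_of_pos`, `Implant.crit_xs` — **in the open quadrant
  `{ũ, ṽ > 0}` the only critical point of `q` is `x⋆ = (z₀, 0)`** (plateau `|p| < P₀`: the
  equations are `p = 0`, `∇N(z) = 0`, `N(z) = n″ < 0`; transition zone: `|p| = |n″ θ' M| ≤
  (r + ε)(C/P₀) ε < P₀` is impossible), under the smallness condition `(r + ε) C ε < P₀²`;
* `Implant.mhessian_q_xs`, `Implant.morseData_q_xs` — **`x⋆` is nondegenerate of index `1`**: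
  near `x⋆`, `q = (p² - N(z)²)/4` is a separated function with Hessian
  `w₃ w'₃/2 - (N(z₀)/2) Hess N(z₀)(dl w, dl w')`, an orthogonal sum of a positive line and a
  positive multiple of `Hess N(z₀)` (`LinearMap.BilinForm.sigNeg_eq_of_line_ker`);
* `Implant.no_crit_j`, `Implant.no_crit_l` — **no critical points of `-ũ_j ṽ_j`, `-ũ_l ṽ_l` in
  the two other open wedges** (relabelled coordinates `(ṽ - ũ, -ũ)`, `(-ṽ, ũ - ṽ)`), under
  `r + ε + (3/2) C ε < 2P₀`;
* `Implant.fderiv_uN_vN_single_three` — `∂₃ ũ > 0 > ∂₃ ṽ` everywhere (`C ε < P₀`);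
  `Implant.uN_vN_eq_of_not_mem`, `Implant.isCompact_box` — the modification is supported in a
  compact box inside `B(q⋆, R)`; `Implant.exists_adaptedChart` — at the points of the new
  corner locus `{ũ = ṽ = 0}` there are local diffeomorphisms of `ℝ⁴` with first coordinates
  `ũ, ṽ` (inverse function theorem, completing by two coordinates of `z`);
* `Implant.exists_implant` — the package consumed by the surgery.

## References

* D. Gay, R. Kirby, *Trisecting 4-manifolds*, Geom. Topol. 20 (2016) 3097–3132, Def. 8,
  Lemma 10 and its proof (stabilisation = adding eyes to a trisected Morse 2-function).
  [GayKirby2016]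
* J. Milnor, *Lectures on the h-cobordism theorem* (1965), Lemma 8.2. [MilnorHCobordism1965]
* J. Milnor, *Morse theory* (1963), §2. [Milnor1963]
-/

open scoped Manifold ContDiff Topology
open Set Function Filter Metric

noncomputable section

namespace Literature.Topology.FourManifolds

namespace Implant

open MorseBirth

/-! ### The recentred birth function on `ℝ³` -/

/-- On the model space, a critical point of a function equal to the coordinate `u ↦ u 0` off a
closed set `K` lies in `K`. [folklore] -/
theorem mem_of_isMCriticalPt_of_eq_coord {n : ℕ} {f : EuclideanSpace ℝ (Fin (n + 1)) → ℝ}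
    {K : Set (EuclideanSpace ℝ (Fin (n + 1)))} (hK : IsClosed K) (hfK : ∀ u ∉ K, f u = u 0)
    {p : EuclideanSpace ℝ (Fin (n + 1))} (hp : IsMCriticalPt (𝓡 (n + 1)) f p) : p ∈ K := by
  by_contra hpK
  rw [isMCriticalPt_iff_fderiv] at hp
  have heq : f =ᶠ[𝓝 p] fun u => u 0 := by
    filter_upwards [hK.isOpen_compl.mem_nhds hpK] with u hu using hfK u hu
  rw [heq.fderiv_eq] at hp
  have h1 : fderiv ℝ (fun u : EuclideanSpace ℝ (Fin (n + 1)) => u 0) p =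
      (EuclideanSpace.proj (0 : Fin (n + 1)) : EuclideanSpace ℝ (Fin (n + 1)) →L[ℝ] ℝ) := by
    have : (fun u : EuclideanSpace ℝ (Fin (n + 1)) => u 0) =
        (EuclideanSpace.proj (0 : Fin (n + 1)) : EuclideanSpace ℝ (Fin (n + 1)) →L[ℝ] ℝ) := by
      ext u; rfl
    rw [this]
    exact (EuclideanSpace.proj (0 : Fin (n + 1)) : EuclideanSpace ℝ (Fin (n + 1)) →L[ℝ] ℝ).fderiv
  rw [h1] at hp
  have := congrArg (fun L : EuclideanSpace ℝ (Fin (n + 1)) →L[ℝ] ℝ =>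
    L (EuclideanSpace.single 0 1)) hp
  simp at this

/-- **Milnor's birth function on `ℝ³`, recentred** (Lemma 8.2 with `(n, λ) = (3, 1)`, small
support, small deviation, and the two critical values on opposite sides of `0`).  For a point
`x₀` of the plane `{z₀ = 0}`, a radius `r` and `ε > 0` there is a Morse function `N` on `ℝ³`
equal to the coordinate `z₀` off a compact subset of `B(x₀, r)`, everywhere `ε`-close to
`z₀`, with exactly two critical points `z₀' ≠ z₁'` of indices `1` and `2` and
`N z₀' < 0 < N z₁'`: the function of `MorseBirth.exists_birthPair_fine` translated along the
`z₀`-axis (source and target) by the mean of its two critical values.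
[cite: MilnorHCobordism1965, Lemma 8.2 (PDF pp. 54–55)] -/
theorem exists_birth_recentred (x₀ : EuclideanSpace ℝ (Fin 3)) (hx₀ : x₀ 0 = 0) {r ε : ℝ}
    (hr : 0 < r) (hε : 0 < ε) :
    ∃ N : EuclideanSpace ℝ (Fin 3) → ℝ, IsMorse (𝓡 3) N ∧
      (∃ K : Set (EuclideanSpace ℝ (Fin 3)), IsCompact K ∧ K ⊆ ball x₀ r ∧ ∀ z ∉ K, N z = z 0) ∧
      (∀ z, |N z - z 0| < ε) ∧
      ∃ z₀ z₁ : EuclideanSpace ℝ (Fin 3), z₀ ≠ z₁ ∧ criticalSet (𝓡 3) N = {z₀, z₁} ∧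
        morseIndex (𝓡 3) N z₀ = 1 ∧ morseIndex (𝓡 3) N z₁ = 2 ∧ N z₀ < 0 ∧ 0 < N z₁ := by
  obtain ⟨f, hf, ⟨K, hK, hKball, hfK⟩, hclose, p₁, p₂, hne, hcrit, hi₁, hi₂, hlt⟩ :=
    exists_birthPair_fine 2 1 (by norm_num) x₀ (r := r / 4) (ε := min ε (r / 4))
      (by positivity) (lt_min hε (by positivity))
  have hfc : ContDiff ℝ ∞ f := contMDiff_iff_contDiff.1 hf.1
  -- the critical points lie in `K`, hence in `B(x₀, r/4)`
  have hpK : ∀ p, p ∈ criticalSet (𝓡 3) f → p ∈ K := fun p hp =>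
    mem_of_isMCriticalPt_of_eq_coord hK.isClosed hfK hp
  have hp₁K : p₁ ∈ K := hpK p₁ (by rw [hcrit]; exact mem_insert _ _)
  have hp₂K : p₂ ∈ K := hpK p₂ (by rw [hcrit]; exact mem_insert_of_mem _ rfl)
  have hcoord : ∀ p ∈ K, |p 0| < r / 4 := by
    intro p hp
    have h1 : dist p x₀ < r / 4 := hKball hp
    rw [dist_eq_norm] at h1
    have h2 : |(p - x₀) 0| ≤ ‖p - x₀‖ := by
      rw [EuclideanSpace.norm_eq]
      refine Real.abs_le_sqrt ?_
      calc (p - x₀) 0 ^ 2 = ‖(p - x₀) 0‖ ^ 2 := by rw [Real.norm_eq_abs, sq_abs]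
        _ ≤ ∑ j, ‖(p - x₀) j‖ ^ 2 := Finset.single_le_sum (f := fun j => ‖(p - x₀) j‖ ^ 2)
            (fun j _ => by positivity) (Finset.mem_univ 0)
    rw [PiLp.sub_apply, hx₀, sub_zero] at h2
    linarith
  have hval : ∀ p ∈ K, |f p| < r / 2 := by
    intro p hp
    have h1 := hcoord p hp
    have h2 : |f p - p 0| < r / 4 := lt_of_lt_of_le (hclose p) (min_le_right _ _)
    calc |f p| = |(f p - p 0) + p 0| := by ring_nf
      _ ≤ |f p - p 0| + |p 0| := abs_add_le _ _
      _ < r / 4 + r / 4 := add_lt_add h2 h1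
      _ = r / 2 := by ring
  -- the shift
  set m : ℝ := (f p₁ + f p₂) / 2 with hm
  have hmabs : |m| < r / 2 := by
    have h1 := hval p₁ hp₁K
    have h2 := hval p₂ hp₂K
    rw [hm, abs_div, abs_two]
    have := abs_add_le (f p₁) (f p₂)
    linarith
  set a : EuclideanSpace ℝ (Fin 3) := EuclideanSpace.single 0 (-m) with ha
  have ha0 : a 0 = -m := by simp [ha]
  have hanorm : ‖a‖ = |m| := by
    rw [ha, EuclideanSpace.single, PiLp.norm_single, Real.norm_eq_abs, abs_neg]
  set N : EuclideanSpace ℝ (Fin 3) → ℝ := rescale a 1 f with hN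
  have hone : (1 : ℝ) ≠ 0 := one_ne_zero
  have hNapply : ∀ z, N z = f (z - a) - m := by
    intro z
    simp only [hN, rescale, MorseBirth.contract, ha0, inv_one, one_smul, one_mul]
    ring
  refine ⟨N, isMorse_rescale one_pos hf, ⟨(fun v => a + (1 : ℝ) • v) '' K,
    hK.image (by fun_prop), ?_, fun z hz => rescale_eq_of_not_mem hone hfK hz⟩, fun z => ?_,
    a + (1 : ℝ) • p₁, a + (1 : ℝ) • p₂, fun h => hne ?_, ?_, ?_, ?_, ?_, ?_⟩
  · rintro _ ⟨v, hv, rfl⟩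
    rw [mem_ball, dist_eq_norm]
    show ‖a + (1 : ℝ) • v - x₀‖ < r
    rw [one_smul]
    have h1 : dist v x₀ < r / 4 := hKball hv
    rw [dist_eq_norm] at h1
    calc ‖a + v - x₀‖ = ‖a + (v - x₀)‖ := by abel_nf
      _ ≤ ‖a‖ + ‖v - x₀‖ := norm_add_le _ _
      _ < r / 2 + r / 4 := by rw [hanorm]; exact add_lt_add hmabs h1
      _ < r := by linarith
  · rw [hN, rescale_sub_apply_zero hone, one_mul]
    exact lt_of_lt_of_le (hclose _) (min_le_left _ _)
  · have := congrArg (MorseBirth.contract a 1) h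
    rwa [contract_expand hone, contract_expand hone] at this
  · rw [hN, criticalSet_rescale hone (hfc.differentiable (by simp)), hcrit, image_pair]
  · rw [hN, morseIndex_rescale one_pos (hfc.of_le (by norm_cast)), contract_expand hone, hi₁]
  · rw [hN, morseIndex_rescale one_pos (hfc.of_le (by norm_cast)), contract_expand hone, hi₂]
  · rw [hNapply]
    simp only [one_smul, add_sub_cancel_left]
    rw [hm]; linarith
  · rw [hNapply]
    simp only [one_smul, add_sub_cancel_left]
    rw [hm]; linarith


/-! ### Coordinates and basis vectors of `ℝ⁴`, `ℝ³` -/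

/-- `dropLast 2` of the basis vector `e₃` of `ℝ⁴` vanishes. [folklore] -/
theorem dropLast_single_three :
    dropLast 2 (EuclideanSpace.single (3 : Fin 4) (1 : ℝ)) = 0 := by
  ext i
  rw [dropLast_apply_coord]
  fin_cases i <;> simp

/-- `dropLast 2` of the basis vector `e_i` of `ℝ⁴`, `i ≤ 2`, is the basis vector `e_i` of `ℝ³`.
[folklore] -/
theorem dropLast_single_castSucc (i : Fin 3) :
    dropLast 2 (EuclideanSpace.single (Fin.castSucc i) (1 : ℝ)) = EuclideanSpace.single i 1 := by
  ext j
  rw [dropLast_apply_coord]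
  by_cases h : j = i
  · subst h; simp
  · have : Fin.castSucc j ≠ Fin.castSucc i := fun h' => h (Fin.castSucc_injective _ h')
    simp [h, this]

/-- A continuous linear functional on `ℝ³` vanishing on the three basis vectors is zero.
[folklore] -/
theorem clm_eq_zero_of_apply_single_three {L : EuclideanSpace ℝ (Fin 3) →L[ℝ] ℝ}
    (h : ∀ i : Fin 3, L (EuclideanSpace.single i 1) = 0) : L = 0 := by
  apply ContinuousLinearMap.coe_injective
  refine (EuclideanSpace.basisFun (Fin 3) ℝ).toBasis.ext fun i => ?_
  simpa using h i

/-- A continuous linear functional on `ℝ⁴` vanishing on the four basis vectors is zero.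
[folklore] -/
theorem clm_eq_zero_of_apply_single_four {L : EuclideanSpace ℝ (Fin 4) →L[ℝ] ℝ}
    (h : ∀ i : Fin 4, L (EuclideanSpace.single i 1) = 0) : L = 0 := by
  apply ContinuousLinearMap.coe_injective
  refine (EuclideanSpace.basisFun (Fin 4) ℝ).toBasis.ext fun i => ?_
  simpa using h i

/-! ### The implanted normal coordinates: first derivatives -/

section Model

variable {N M : EuclideanSpace ℝ (Fin 3) → ℝ} {P₀ : ℝ}
  {nN uN vN q : EuclideanSpace ℝ (Fin 4) → ℝ}

/-- The derivative of the modified anti-diagonal coordinate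
`n″(x) = x₀ + θ_{P₀}(x₃) · M(x₀, x₁, x₂)`. [folklore] -/
theorem hasFDerivAt_nN (hMs : ContDiff ℝ ∞ M)
    (hnN : ∀ x, nN x = x 0 + θR P₀ (x 3) * M (dropLast 2 x)) (x : EuclideanSpace ℝ (Fin 4)) :
    HasFDerivAt nN
      ((EuclideanSpace.proj (0 : Fin 4) : EuclideanSpace ℝ (Fin 4) →L[ℝ] ℝ) +
        (θR P₀ (x 3) • (fderiv ℝ M (dropLast 2 x)).comp (dropLast 2) +
          M (dropLast 2 x) • (deriv (θR P₀) (x 3) •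
            (EuclideanSpace.proj (3 : Fin 4) : EuclideanSpace ℝ (Fin 4) →L[ℝ] ℝ)))) x := by
  have hfun : nN = fun x => x 0 + θR P₀ (x 3) * M (dropLast 2 x) := funext hnN
  rw [hfun]
  have h0 : HasFDerivAt (fun x : EuclideanSpace ℝ (Fin 4) => x 0)
      (EuclideanSpace.proj (0 : Fin 4) : EuclideanSpace ℝ (Fin 4) →L[ℝ] ℝ) x :=
    (EuclideanSpace.proj (0 : Fin 4) : EuclideanSpace ℝ (Fin 4) →L[ℝ] ℝ).hasFDerivAt
  have h3 : HasFDerivAt (fun x : EuclideanSpace ℝ (Fin 4) => x 3)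
      (EuclideanSpace.proj (3 : Fin 4) : EuclideanSpace ℝ (Fin 4) →L[ℝ] ℝ) x :=
    (EuclideanSpace.proj (3 : Fin 4) : EuclideanSpace ℝ (Fin 4) →L[ℝ] ℝ).hasFDerivAt
  have hθ : HasFDerivAt (fun x : EuclideanSpace ℝ (Fin 4) => θR P₀ (x 3))
      (deriv (θR P₀) (x 3) • (EuclideanSpace.proj (3 : Fin 4) : EuclideanSpace ℝ (Fin 4) →L[ℝ] ℝ)) x :=
    ((θR_contDiff (m := 1) (R := P₀)).differentiable (by simp) _).hasDerivAt.comp_hasFDerivAt x h3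
  have hM : HasFDerivAt (fun x : EuclideanSpace ℝ (Fin 4) => M (dropLast 2 x))
      ((fderiv ℝ M (dropLast 2 x)).comp (dropLast 2)) x :=
    ((hMs.differentiable (by simp)) _).hasFDerivAt.comp x (dropLast 2).hasFDerivAt
  exact h0.add (hθ.mul hM)

/-- The derivative of `q = (x₃² - n″²)/4 = -uN vN`. [folklore] -/
theorem hasFDerivAt_q (hMs : ContDiff ℝ ∞ M)
    (hnN : ∀ x, nN x = x 0 + θR P₀ (x 3) * M (dropLast 2 x))
    (hq : ∀ x, q x = (x 3 ^ 2 - nN x ^ 2) / 4) (x : EuclideanSpace ℝ (Fin 4)) :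
    HasFDerivAt q
      ((x 3 / 2) • (EuclideanSpace.proj (3 : Fin 4) : EuclideanSpace ℝ (Fin 4) →L[ℝ] ℝ) -
        (nN x / 2) • ((EuclideanSpace.proj (0 : Fin 4) : EuclideanSpace ℝ (Fin 4) →L[ℝ] ℝ) +
        (θR P₀ (x 3) • (fderiv ℝ M (dropLast 2 x)).comp (dropLast 2) +
          M (dropLast 2 x) • (deriv (θR P₀) (x 3) •
            (EuclideanSpace.proj (3 : Fin 4) : EuclideanSpace ℝ (Fin 4) →L[ℝ] ℝ))))) x := by
  have hfun : q = fun x => (1 / 4 : ℝ) * (x 3 * x 3 - nN x * nN x) := by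
    funext x; rw [hq]; ring
  rw [hfun]
  have h3 : HasFDerivAt (fun x : EuclideanSpace ℝ (Fin 4) => x 3)
      (EuclideanSpace.proj (3 : Fin 4) : EuclideanSpace ℝ (Fin 4) →L[ℝ] ℝ) x :=
    (EuclideanSpace.proj (3 : Fin 4) : EuclideanSpace ℝ (Fin 4) →L[ℝ] ℝ).hasFDerivAt
  have hn := hasFDerivAt_nN hMs hnN x
  have h := ((h3.mul h3).sub (hn.mul hn)).const_mul (1 / 4 : ℝ)
  refine h.congr_fderiv ?_
  ext w
  simp only [sub_apply, smul_apply, add_apply, smul_eq_mul]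
  ring

/-- `uN vN = (n″² - x₃²)/4`, so `q = -uN vN`. [folklore] -/
theorem q_eq_neg_mul (huN : ∀ x, uN x = (x 3 - nN x) / 2) (hvN : ∀ x, vN x = (-x 3 - nN x) / 2)
    (hq : ∀ x, q x = (x 3 ^ 2 - nN x ^ 2) / 4) (x : EuclideanSpace ℝ (Fin 4)) :
    q x = -(uN x * vN x) := by
  rw [hq, huN, hvN]; ring

/-- `uN - vN = x₃` and `uN + vN = -n″`. [folklore] -/
theorem uN_sub_vN (huN : ∀ x, uN x = (x 3 - nN x) / 2) (hvN : ∀ x, vN x = (-x 3 - nN x) / 2)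
    (x : EuclideanSpace ℝ (Fin 4)) : uN x - vN x = x 3 ∧ uN x + vN x = -nN x := by
  rw [huN, hvN]; constructor <;> ring

/-! ### Evaluating the derivatives on the basis vectors -/

/-- The derivative of `n″` on `e₃`: `θ'_{P₀}(x₃) M(z)`. [folklore] -/
theorem nN'_single_three (x : EuclideanSpace ℝ (Fin 4)) :
    ((EuclideanSpace.proj (0 : Fin 4) : EuclideanSpace ℝ (Fin 4) →L[ℝ] ℝ) +
        (θR P₀ (x 3) • (fderiv ℝ M (dropLast 2 x)).comp (dropLast 2) +
          M (dropLast 2 x) • (deriv (θR P₀) (x 3) •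
            (EuclideanSpace.proj (3 : Fin 4) : EuclideanSpace ℝ (Fin 4) →L[ℝ] ℝ))))
      (EuclideanSpace.single 3 1) = deriv (θR P₀) (x 3) * M (dropLast 2 x) := by
  simp [dropLast_single_three, mul_comm]

/-- The derivative of `n″` on `e_i`, `i ≤ 2`: `δ_{i0} + θ_{P₀}(x₃) ∂_i M(z)`. [folklore] -/
theorem nN'_single_castSucc (x : EuclideanSpace ℝ (Fin 4)) (i : Fin 3) :
    ((EuclideanSpace.proj (0 : Fin 4) : EuclideanSpace ℝ (Fin 4) →L[ℝ] ℝ) +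
        (θR P₀ (x 3) • (fderiv ℝ M (dropLast 2 x)).comp (dropLast 2) +
          M (dropLast 2 x) • (deriv (θR P₀) (x 3) •
            (EuclideanSpace.proj (3 : Fin 4) : EuclideanSpace ℝ (Fin 4) →L[ℝ] ℝ))))
      (EuclideanSpace.single (Fin.castSucc i) 1) =
      (if i = 0 then 1 else 0) + θR P₀ (x 3) * fderiv ℝ M (dropLast 2 x) (EuclideanSpace.single i 1) := by
  rw [show (EuclideanSpace.single (Fin.castSucc i) (1 : ℝ) : EuclideanSpace ℝ (Fin 4)) =
      EuclideanSpace.single (Fin.castSucc i) 1 from rfl]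
  have key := dropLast_single_castSucc i
  fin_cases i <;> simp_all


/-! ### The perturbation `M = N - z₀`: support and size -/

/-- `M = N - z₀` is smooth. [folklore] -/
theorem contDiff_M (hNs : ContDiff ℝ ∞ N) (hMdef : ∀ z, M z = N z - z 0) : ContDiff ℝ ∞ M := by
  have : M = fun z => N z - z 0 := funext hMdef
  rw [this]
  exact hNs.sub ((EuclideanSpace.proj (0 : Fin 3) : EuclideanSpace ℝ (Fin 3) →L[ℝ] ℝ).contDiff)

/-- `fderiv M z = fderiv N z - proj 0`. [folklore] -/
theorem fderiv_M (hNs : ContDiff ℝ ∞ N) (hMdef : ∀ z, M z = N z - z 0) (z : EuclideanSpace ℝ (Fin 3)) :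
    fderiv ℝ M z = fderiv ℝ N z -
      (EuclideanSpace.proj (0 : Fin 3) : EuclideanSpace ℝ (Fin 3) →L[ℝ] ℝ) := by
  have : M = fun z => N z - z 0 := funext hMdef
  rw [this]
  have hN := ((hNs.differentiable (by simp)) z).hasFDerivAt
  have h0 := (EuclideanSpace.proj (0 : Fin 3) : EuclideanSpace ℝ (Fin 3) →L[ℝ] ℝ).hasFDerivAt (x := z)
  exact (hN.sub h0).fderiv

/-- `∂_i M = ∂_i N - δ_{i0}` on the basis vectors. [folklore] -/
theorem fderiv_M_single (hNs : ContDiff ℝ ∞ N) (hMdef : ∀ z, M z = N z - z 0)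
    (z : EuclideanSpace ℝ (Fin 3)) (i : Fin 3) :
    fderiv ℝ M z (EuclideanSpace.single i 1) =
      fderiv ℝ N z (EuclideanSpace.single i 1) - if i = 0 then 1 else 0 := by
  rw [fderiv_M hNs hMdef]
  fin_cases i <;> simp

/-- Off the exceptional compact set `K` (where `N = z₀`), `M` vanishes identically near the
point, so `M z = 0` and `fderiv M z = 0`. [folklore] -/
theorem M_eq_zero_of_not_mem (hMdef : ∀ z, M z = N z - z 0) {K : Set (EuclideanSpace ℝ (Fin 3))}
    (hNK : ∀ z ∉ K, N z = z 0) {z : EuclideanSpace ℝ (Fin 3)} (hz : z ∉ K) : M z = 0 := by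
  rw [hMdef, hNK z hz, sub_self]

/-- `fderiv M z ≠ 0` forces `z ∈ K`. [folklore] -/
theorem mem_of_fderiv_M_ne_zero (hMdef : ∀ z, M z = N z - z 0) {K : Set (EuclideanSpace ℝ (Fin 3))}
    (hK : IsClosed K) (hNK : ∀ z ∉ K, N z = z 0) {z : EuclideanSpace ℝ (Fin 3)}
    (hz : fderiv ℝ M z ≠ 0) : z ∈ K := by
  by_contra hzK
  apply hz
  have heq : M =ᶠ[𝓝 z] fun _ => 0 := by
    filter_upwards [hK.isOpen_compl.mem_nhds hzK] with w hw using M_eq_zero_of_not_mem hMdef hNK hw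
  rw [heq.fderiv_eq, fderiv_const_apply]

/-- A point of `K ⊆ B(x₀, r)` with `x₀` on the plane `{z₀ = 0}` has `|z₀| < r`. [folklore] -/
theorem abs_apply_zero_lt_of_mem {K : Set (EuclideanSpace ℝ (Fin 3))} {x₀ : EuclideanSpace ℝ (Fin 3)}
    {r : ℝ} (hKball : K ⊆ ball x₀ r) (hx₀ : x₀ 0 = 0) {z : EuclideanSpace ℝ (Fin 3)} (hz : z ∈ K) :
    |z 0| < r := by
  have h1 : dist z x₀ < r := hKball hz
  rw [dist_eq_norm] at h1
  have h2 : |(z - x₀) 0| ≤ ‖z - x₀‖ := by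
    rw [EuclideanSpace.norm_eq]
    refine Real.abs_le_sqrt ?_
    calc (z - x₀) 0 ^ 2 = ‖(z - x₀) 0‖ ^ 2 := by rw [Real.norm_eq_abs, sq_abs]
      _ ≤ ∑ j, ‖(z - x₀) j‖ ^ 2 := Finset.single_le_sum (f := fun j => ‖(z - x₀) j‖ ^ 2)
          (fun j _ => by positivity) (Finset.mem_univ 0)
  rw [PiLp.sub_apply, hx₀, sub_zero] at h2
  linarith

/-- `|M| < ε` everywhere. [folklore] -/
theorem abs_M_lt (hMdef : ∀ z, M z = N z - z 0) {ε : ℝ} (hε : ∀ z, |N z - z 0| < ε)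
    (z : EuclideanSpace ℝ (Fin 3)) : |M z| < ε := by
  rw [hMdef]; exact hε z

/-- The critical points of `N`: `fderiv N z = 0 ↔ z = z₀ ∨ z = z₁`. [folklore] -/
theorem fderiv_N_eq_zero_iff {z₀ z₁ : EuclideanSpace ℝ (Fin 3)}
    (hcrit : criticalSet (𝓡 3) N = {z₀, z₁}) (z : EuclideanSpace ℝ (Fin 3)) :
    fderiv ℝ N z = 0 ↔ z = z₀ ∨ z = z₁ := by
  rw [← isMCriticalPt_iff_fderiv, ← mem_criticalSet (I := 𝓡 3), hcrit]
  simp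

/-! ### `dropLast` and the coordinates -/

/-- `(dropLast 2 x) 0 = x 0`. [folklore] -/
theorem dropLast_two_apply_zero (x : EuclideanSpace ℝ (Fin 4)) : dropLast 2 x 0 = x 0 :=
  dropLast_apply_zero 2 x

/-- A point of `ℝ⁴` is determined by `dropLast` and its last coordinate. [folklore] -/
theorem eq_of_dropLast_eq {x y : EuclideanSpace ℝ (Fin 4)} (h : dropLast 2 x = dropLast 2 y)
    (h3 : x 3 = y 3) : x = y := by
  ext i
  fin_cases i
  · have := congrArg (fun z : EuclideanSpace ℝ (Fin 3) => z 0) h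
    simpa [dropLast_apply_coord] using this
  · have := congrArg (fun z : EuclideanSpace ℝ (Fin 3) => z 1) h
    simpa [dropLast_apply_coord] using this
  · have := congrArg (fun z : EuclideanSpace ℝ (Fin 3) => z 2) h
    simpa [dropLast_apply_coord] using this
  · exact h3

/-! ### The critical points of `q = -ũ ṽ` -/

/-- **The critical-point equations of `q`**, read on the basis vectors: if `fderiv q x = 0`
then `x₃ = n″ θ' M`, `n″ (1 + θ ∂₀M) = 0`, `n″ θ ∂₁M = 0`, `n″ θ ∂₂M = 0`.
[cite: GayKirby2016, proof of Lemma 10] -/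
theorem crit_equations (hMs : ContDiff ℝ ∞ M)
    (hnN : ∀ x, nN x = x 0 + θR P₀ (x 3) * M (dropLast 2 x))
    (hq : ∀ x, q x = (x 3 ^ 2 - nN x ^ 2) / 4) {x : EuclideanSpace ℝ (Fin 4)}
    (hx : fderiv ℝ q x = 0) :
    x 3 = nN x * (deriv (θR P₀) (x 3) * M (dropLast 2 x)) ∧
    nN x * (1 + θR P₀ (x 3) * fderiv ℝ M (dropLast 2 x) (EuclideanSpace.single 0 1)) = 0 ∧
    nN x * (θR P₀ (x 3) * fderiv ℝ M (dropLast 2 x) (EuclideanSpace.single 1 1)) = 0 ∧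
    nN x * (θR P₀ (x 3) * fderiv ℝ M (dropLast 2 x) (EuclideanSpace.single 2 1)) = 0 := by
  have hd := (hasFDerivAt_q hMs hnN hq x).fderiv
  rw [hx] at hd
  have happly : ∀ w : EuclideanSpace ℝ (Fin 4),
      (x 3 / 2) * w 3 - (nN x / 2) *
        (((EuclideanSpace.proj (0 : Fin 4) : EuclideanSpace ℝ (Fin 4) →L[ℝ] ℝ) +
          (θR P₀ (x 3) • (fderiv ℝ M (dropLast 2 x)).comp (dropLast 2) +
            M (dropLast 2 x) • (deriv (θR P₀) (x 3) •
              (EuclideanSpace.proj (3 : Fin 4) : EuclideanSpace ℝ (Fin 4) →L[ℝ] ℝ)))) w) = 0 := by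
    intro w
    have := congrArg (fun L : EuclideanSpace ℝ (Fin 4) →L[ℝ] ℝ => L w) hd
    simp only [zero_apply, sub_apply, smul_apply, smul_eq_mul] at this
    have h3 : (EuclideanSpace.proj (3 : Fin 4) : EuclideanSpace ℝ (Fin 4) →L[ℝ] ℝ) w = w 3 := rfl
    rw [h3] at this
    linarith
  have e3 := happly (EuclideanSpace.single 3 1)
  rw [nN'_single_three] at e3
  have s33 : (EuclideanSpace.single (3 : Fin 4) (1 : ℝ) : EuclideanSpace ℝ (Fin 4)) 3 = 1 := by simp
  rw [s33] at e3
  have e0 := happly (EuclideanSpace.single (Fin.castSucc (0 : Fin 3)) 1)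
  rw [nN'_single_castSucc] at e0
  have s03 : (EuclideanSpace.single (Fin.castSucc (0 : Fin 3)) (1 : ℝ) : EuclideanSpace ℝ (Fin 4)) 3 = 0 := by
    rw [EuclideanSpace.single, PiLp.single_apply, if_neg (by decide)]
  rw [s03, if_pos rfl] at e0
  have e1 := happly (EuclideanSpace.single (Fin.castSucc (1 : Fin 3)) 1)
  rw [nN'_single_castSucc] at e1
  have s13 : (EuclideanSpace.single (Fin.castSucc (1 : Fin 3)) (1 : ℝ) : EuclideanSpace ℝ (Fin 4)) 3 = 0 := by
    rw [EuclideanSpace.single, PiLp.single_apply, if_neg (by decide)]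
  rw [s13, if_neg (show (1 : Fin 3) ≠ 0 by decide)] at e1
  have e2 := happly (EuclideanSpace.single (Fin.castSucc (2 : Fin 3)) 1)
  rw [nN'_single_castSucc] at e2
  have s23 : (EuclideanSpace.single (Fin.castSucc (2 : Fin 3)) (1 : ℝ) : EuclideanSpace ℝ (Fin 4)) 3 = 0 := by
    rw [EuclideanSpace.single, PiLp.single_apply, if_neg (by decide)]
  rw [s23, if_neg (show (2 : Fin 3) ≠ 0 by decide)] at e2
  refine ⟨by linarith, by linarith, by linarith, by linarith⟩

/-- **The derivative of `q` at a point with `x₃ = 0` over a critical point of `N` vanishes.**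
[cite: GayKirby2016, proof of Lemma 10] -/
theorem fderiv_q_eq_zero_of (hNs : ContDiff ℝ ∞ N) (hMdef : ∀ z, M z = N z - z 0) (hP₀ : 0 < P₀)
    (hnN : ∀ x, nN x = x 0 + θR P₀ (x 3) * M (dropLast 2 x))
    (hq : ∀ x, q x = (x 3 ^ 2 - nN x ^ 2) / 4) {x : EuclideanSpace ℝ (Fin 4)} (hx3 : x 3 = 0)
    (hN0 : fderiv ℝ N (dropLast 2 x) = 0) : fderiv ℝ q x = 0 := by
  have hMs := contDiff_M hNs hMdef
  rw [(hasFDerivAt_q hMs hnN hq x).fderiv, hx3, deriv_θR_eq_zero hP₀ (by simp [hP₀]), θR_zero,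
    fderiv_M hNs hMdef, hN0]
  ext w
  simp [dropLast_apply_coord]

/-- **The unique critical point of `q` in the open quadrant `{ũ > 0, ṽ > 0}`.**  Under the
smallness conditions on the implant (`(r + ε) C ε < P₀²`, where `|θ'| ≤ C`, the support of
`M` lies over `B(x₀, r)` with `x₀` on the plane `{z₀ = 0}`, and `|M| < ε`), a critical point
of `q = -ũ ṽ` with `ũ, ṽ > 0` is the point `x⋆` over the critical point `z₀` of `N` of
negative value, with `x⋆₃ = 0`: on the plateau `|x₃| < P₀` the equations say `x₃ = 0` and
`∇N(z) = 0` with `N(z) = n″ < 0`; in the transition zone `P₀ ≤ |x₃| < 3P₀/2` they force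
`|x₃| = |n″ θ' M| ≤ (r + ε)(C/P₀) ε < P₀`. [cite: GayKirby2016, proof of Lemma 10] -/
theorem eq_of_fderiv_q_eq_zero_of_pos (hNs : ContDiff ℝ ∞ N) (hMdef : ∀ z, M z = N z - z 0)
    {K : Set (EuclideanSpace ℝ (Fin 3))} (hK : IsClosed K) {x₀ : EuclideanSpace ℝ (Fin 3)} {r : ℝ}
    (hKball : K ⊆ ball x₀ r) (hx₀ : x₀ 0 = 0) (hNK : ∀ z ∉ K, N z = z 0)
    {ε : ℝ} (hε : ∀ z, |N z - z 0| < ε)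
    {z₀ z₁ : EuclideanSpace ℝ (Fin 3)} (hcrit : criticalSet (𝓡 3) N = {z₀, z₁}) (hz₁ : 0 < N z₁)
    (hP₀ : 0 < P₀) {C : ℝ} (hC : ∀ t, |deriv θ t| ≤ C) (hpar : (r + ε) * C * ε < P₀ ^ 2)
    (hnN : ∀ x, nN x = x 0 + θR P₀ (x 3) * M (dropLast 2 x))
    (huN : ∀ x, uN x = (x 3 - nN x) / 2) (hvN : ∀ x, vN x = (-x 3 - nN x) / 2)
    (hq : ∀ x, q x = (x 3 ^ 2 - nN x ^ 2) / 4)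
    {xs : EuclideanSpace ℝ (Fin 4)} (hxs : dropLast 2 xs = z₀) (hxs3 : xs 3 = 0)
    {x : EuclideanSpace ℝ (Fin 4)} (hu : 0 < uN x) (hv : 0 < vN x) (hx : fderiv ℝ q x = 0) :
    x = xs := by
  have hMs := contDiff_M hNs hMdef
  set z := dropLast 2 x with hz
  have hnNneg : nN x < 0 := by have := (uN_sub_vN huN hvN x).2; linarith
  have hnNne : nN x ≠ 0 := hnNneg.ne
  obtain ⟨e3, e0, e1, e2⟩ := crit_equations hMs hnN hq hx
  -- the equations without the factor `n″`
  have e0' : 1 + θR P₀ (x 3) * fderiv ℝ M z (EuclideanSpace.single 0 1) = 0 :=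
    (mul_eq_zero.1 e0).resolve_left hnNne
  have e1' : θR P₀ (x 3) * fderiv ℝ M z (EuclideanSpace.single 1 1) = 0 :=
    (mul_eq_zero.1 e1).resolve_left hnNne
  have e2' : θR P₀ (x 3) * fderiv ℝ M z (EuclideanSpace.single 2 1) = 0 :=
    (mul_eq_zero.1 e2).resolve_left hnNne
  -- `θ ≠ 0` and `∂₀ M ≠ 0`
  have hθne : θR P₀ (x 3) ≠ 0 := by
    intro h0; rw [h0, zero_mul, add_zero] at e0'; exact one_ne_zero e0'
  have hM0ne : fderiv ℝ M z (EuclideanSpace.single 0 1) ≠ 0 := by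
    intro h0; rw [h0, mul_zero, add_zero] at e0'; exact one_ne_zero e0'
  have hzK : z ∈ K := mem_of_fderiv_M_ne_zero hMdef hK hNK (fun h0 => hM0ne (by rw [h0]; rfl))
  have hz0 : |z 0| < r := abs_apply_zero_lt_of_mem hKball hx₀ hzK
  have hx0 : x 0 = z 0 := (dropLast_two_apply_zero x).symm
  -- bound on `n″`
  have hnNabs : |nN x| < r + ε := by
    rw [hnN, hx0]
    have h1 : |θR P₀ (x 3) * M z| ≤ |M z| := by
      rw [abs_mul]
      exact mul_le_of_le_one_left (abs_nonneg _) (abs_θR_le_one _)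
    have h2 := abs_M_lt hMdef hε z
    calc |z 0 + θR P₀ (x 3) * M z| ≤ |z 0| + |θR P₀ (x 3) * M z| := abs_add_le _ _
      _ < r + ε := by linarith
  by_cases hplat : |x 3| < P₀
  · -- ### the plateau
    have hθ1 : θR P₀ (x 3) = 1 := θR_eq_one hP₀ hplat.le
    have hθ'0 : deriv (θR P₀) (x 3) = 0 := deriv_θR_eq_zero hP₀ hplat
    have hx3 : x 3 = 0 := by rw [e3, hθ'0]; ring
    rw [hθ1, one_mul] at e0' e1' e2'
    -- `∇N(z) = 0`
    have hN0 : fderiv ℝ N z = 0 := by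
      apply clm_eq_zero_of_apply_single_three
      intro i
      have hi := fderiv_M_single hNs hMdef z i
      by_cases hi0 : i = 0
      · subst hi0
        rw [if_pos rfl] at hi
        linarith
      · rw [if_neg hi0, sub_zero] at hi
        have hMi : fderiv ℝ M z (EuclideanSpace.single i 1) = 0 := by
          fin_cases i
          · exact absurd rfl hi0
          · exact e1'
          · exact e2'
        rw [← hi, hMi]
    have hzcrit : z = z₀ ∨ z = z₁ := (fderiv_N_eq_zero_iff hcrit z).1 hN0
    -- the value: `n″ = N z < 0`
    have hval : nN x = N z := by rw [hnN, hθ1, one_mul, hMdef, hx0]; ring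
    have hz₀ : z = z₀ := by
      rcases hzcrit with h | h
      · exact h
      · rw [hval, h] at hnNneg; linarith
    exact eq_of_dropLast_eq (by rw [← hz, hz₀, hxs]) (by rw [hx3, hxs3])
  · -- ### the transition zone: impossible
    exfalso
    rw [not_lt] at hplat
    have hCP : |deriv (θR P₀) (x 3)| ≤ C / P₀ := abs_deriv_θR_le hP₀ hC _
    have hC0 : 0 ≤ C := le_trans (abs_nonneg _) (hC 0)
    have hMz := abs_M_lt hMdef hε z
    have hεpos : 0 < ε := lt_of_le_of_lt (abs_nonneg _) hMz
    have key : |x 3| ≤ |nN x| * (C / P₀) * ε := by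
      rw [e3, abs_mul, abs_mul, mul_assoc]
      refine mul_le_mul_of_nonneg_left ?_ (abs_nonneg _)
      exact mul_le_mul hCP hMz.le (abs_nonneg _) (div_nonneg hC0 hP₀.le)
    have key2 : |nN x| * (C / P₀) * ε ≤ (r + ε) * (C / P₀) * ε := by
      gcongr
    have key3 : (r + ε) * (C / P₀) * ε < P₀ := by
      rw [show (r + ε) * (C / P₀) * ε = ((r + ε) * C * ε) / P₀ by ring, div_lt_iff₀ hP₀]
      nlinarith
    linarith

/-- **The critical point `x⋆` over `z₀`: it lies in the open quadrant and is critical.**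
[cite: GayKirby2016, proof of Lemma 10] -/
theorem crit_xs (hNs : ContDiff ℝ ∞ N) (hMdef : ∀ z, M z = N z - z 0)
    {z₀ z₁ : EuclideanSpace ℝ (Fin 3)} (hcrit : criticalSet (𝓡 3) N = {z₀, z₁}) (hz₀ : N z₀ < 0)
    (hP₀ : 0 < P₀)
    (hnN : ∀ x, nN x = x 0 + θR P₀ (x 3) * M (dropLast 2 x))
    (huN : ∀ x, uN x = (x 3 - nN x) / 2) (hvN : ∀ x, vN x = (-x 3 - nN x) / 2)
    (hq : ∀ x, q x = (x 3 ^ 2 - nN x ^ 2) / 4)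
    {xs : EuclideanSpace ℝ (Fin 4)} (hxs : dropLast 2 xs = z₀) (hxs3 : xs 3 = 0) :
    0 < uN xs ∧ 0 < vN xs ∧ fderiv ℝ q xs = 0 ∧ nN xs = N z₀ := by
  have hval : nN xs = N z₀ := by
    rw [hnN, hxs3, θR_zero, one_mul, hMdef, hxs, ← dropLast_two_apply_zero xs, hxs]; ring
  refine ⟨?_, ?_, ?_, hval⟩
  · rw [huN, hxs3, hval]; linarith
  · rw [hvN, hxs3, hval]; linarith
  · exact fderiv_q_eq_zero_of hNs hMdef hP₀ hnN hq hxs3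
      ((fderiv_N_eq_zero_iff hcrit _).2 (Or.inl hxs))


/-! ### The Hessian of `q` at `x⋆` -/

/-- Near `x⋆` (indeed wherever `|x₃| < P₀`) the function `q` is the separated function
`(x₃² - N(z)²)/4`. [folklore] -/
theorem q_eventuallyEq (hMdef : ∀ z, M z = N z - z 0) (hP₀ : 0 < P₀)
    (hnN : ∀ x, nN x = x 0 + θR P₀ (x 3) * M (dropLast 2 x))
    (hq : ∀ x, q x = (x 3 ^ 2 - nN x ^ 2) / 4) {xs : EuclideanSpace ℝ (Fin 4)} (hxs3 : xs 3 = 0) :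
    q =ᶠ[𝓝 xs] fun x => (x 3 ^ 2 - N (dropLast 2 x) ^ 2) / 4 := by
  have hopen : IsOpen {x : EuclideanSpace ℝ (Fin 4) | |x 3| < P₀} :=
    isOpen_lt (continuous_abs.comp (continuous_apply 3 |>.comp (PiLp.continuous_ofLp 2 _)))
      continuous_const
  have hmem : xs ∈ {x : EuclideanSpace ℝ (Fin 4) | |x 3| < P₀} := by
    show |xs 3| < P₀; rw [hxs3, abs_zero]; exact hP₀
  filter_upwards [hopen.mem_nhds hmem] with x hx
  have hx' : |x 3| < P₀ := hx
  rw [hq, hnN, θR_eq_one hP₀ hx'.le, one_mul, hMdef, dropLast_two_apply_zero]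
  ring

/-- The derivative of the separated function `h = (x₃² - N(z)²)/4`. [folklore] -/
theorem hasFDerivAt_sep (hNs : ContDiff ℝ ∞ N) (x : EuclideanSpace ℝ (Fin 4)) :
    HasFDerivAt (fun x : EuclideanSpace ℝ (Fin 4) => (x 3 ^ 2 - N (dropLast 2 x) ^ 2) / 4)
      ((x 3 / 2) • (EuclideanSpace.proj (3 : Fin 4) : EuclideanSpace ℝ (Fin 4) →L[ℝ] ℝ) -
        (N (dropLast 2 x) / 2) • ((fderiv ℝ N (dropLast 2 x)).comp (dropLast 2))) x := by
  have hfun : (fun x : EuclideanSpace ℝ (Fin 4) => (x 3 ^ 2 - N (dropLast 2 x) ^ 2) / 4) =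
      fun x => (1 / 4 : ℝ) * (x 3 * x 3 - N (dropLast 2 x) * N (dropLast 2 x)) := by
    funext x; ring
  rw [hfun]
  have h3 : HasFDerivAt (fun x : EuclideanSpace ℝ (Fin 4) => x 3)
      (EuclideanSpace.proj (3 : Fin 4) : EuclideanSpace ℝ (Fin 4) →L[ℝ] ℝ) x :=
    (EuclideanSpace.proj (3 : Fin 4) : EuclideanSpace ℝ (Fin 4) →L[ℝ] ℝ).hasFDerivAt
  have hN : HasFDerivAt (fun x : EuclideanSpace ℝ (Fin 4) => N (dropLast 2 x))
      ((fderiv ℝ N (dropLast 2 x)).comp (dropLast 2)) x :=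
    ((hNs.differentiable (by simp)) _).hasFDerivAt.comp x (dropLast 2).hasFDerivAt
  have h := ((h3.mul h3).sub (hN.mul hN)).const_mul (1 / 4 : ℝ)
  refine h.congr_fderiv ?_
  ext w
  simp only [sub_apply, smul_apply, add_apply, smul_eq_mul]
  ring

/-- **The second derivative of `q` at `x⋆`**:
`D²q(x⋆)(w, w') = w₃ w'₃ / 2 - (N(z₀)/2) D²N(z₀)(dl w, dl w')`. [cite: GayKirby2016, proof of Lemma 10] -/
theorem fderiv_fderiv_q_xs (hNs : ContDiff ℝ ∞ N) (hMdef : ∀ z, M z = N z - z 0) (hP₀ : 0 < P₀)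
    {z₀ z₁ : EuclideanSpace ℝ (Fin 3)} (hcrit : criticalSet (𝓡 3) N = {z₀, z₁})
    (hnN : ∀ x, nN x = x 0 + θR P₀ (x 3) * M (dropLast 2 x))
    (hq : ∀ x, q x = (x 3 ^ 2 - nN x ^ 2) / 4)
    {xs : EuclideanSpace ℝ (Fin 4)} (hxs : dropLast 2 xs = z₀) (hxs3 : xs 3 = 0)
    (w w' : EuclideanSpace ℝ (Fin 4)) :
    fderiv ℝ (fderiv ℝ q) xs w w' =
      w 3 * w' 3 / 2 - (N z₀ / 2) * fderiv ℝ (fderiv ℝ N) z₀ (dropLast 2 w) (dropLast 2 w') := by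
  -- replace `q` by the separated function `h`
  set h : EuclideanSpace ℝ (Fin 4) → ℝ := fun x => (x 3 ^ 2 - N (dropLast 2 x) ^ 2) / 4 with hh
  have heq : q =ᶠ[𝓝 xs] h := q_eventuallyEq hMdef hP₀ hnN hq hxs3
  rw [heq.fderiv.fderiv_eq]
  -- the first derivative of `h` as a function
  set h' : EuclideanSpace ℝ (Fin 4) → (EuclideanSpace ℝ (Fin 4) →L[ℝ] ℝ) := fun x =>
    (x 3 / 2) • (EuclideanSpace.proj (3 : Fin 4) : EuclideanSpace ℝ (Fin 4) →L[ℝ] ℝ) -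
      (N (dropLast 2 x) / 2) • ((fderiv ℝ N (dropLast 2 x)).comp (dropLast 2)) with hh'
  have hfd : fderiv ℝ h = h' := funext fun x => (hasFDerivAt_sep hNs x).fderiv
  rw [hfd]
  -- ### differentiate `h'` at `xs`
  have hN0 : fderiv ℝ N z₀ = 0 := (fderiv_N_eq_zero_iff hcrit z₀).2 (Or.inl rfl)
  -- the precomposition-with-`dropLast` operator
  set Φ : (EuclideanSpace ℝ (Fin 3) →L[ℝ] ℝ) →L[ℝ] (EuclideanSpace ℝ (Fin 4) →L[ℝ] ℝ) :=
    (ContinuousLinearMap.compL ℝ (EuclideanSpace ℝ (Fin 4)) (EuclideanSpace ℝ (Fin 3)) ℝ).flip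
      (dropLast 2) with hΦ
  have hΦapply : ∀ L : EuclideanSpace ℝ (Fin 3) →L[ℝ] ℝ, Φ L = L.comp (dropLast 2) := fun L => rfl
  -- `G x = (fderiv N (dl x)).comp dl = Φ (fderiv N (dl x))`
  have hN2 : ContDiff ℝ 1 (fderiv ℝ N) := hNs.fderiv_right (by norm_cast)
  have hGd : HasFDerivAt (fun x : EuclideanSpace ℝ (Fin 4) => (fderiv ℝ N (dropLast 2 x)).comp (dropLast 2))
      (Φ.comp ((fderiv ℝ (fderiv ℝ N) z₀).comp (dropLast 2))) xs := by
    have h1 : HasFDerivAt (fun x : EuclideanSpace ℝ (Fin 4) => fderiv ℝ N (dropLast 2 x))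
        ((fderiv ℝ (fderiv ℝ N) z₀).comp (dropLast 2)) xs := by
      have := (hN2.differentiable (by simp) z₀).hasFDerivAt
      rw [← hxs] at this ⊢
      exact this.comp xs (dropLast 2).hasFDerivAt
    have h2 := Φ.hasFDerivAt.comp xs h1
    exact h2
  have hcd : HasFDerivAt (fun x : EuclideanSpace ℝ (Fin 4) => N (dropLast 2 x) / 2)
      ((1 / 2 : ℝ) • ((fderiv ℝ N (dropLast 2 xs)).comp (dropLast 2))) xs := by
    have := (((hNs.differentiable (by simp)) _).hasFDerivAt.comp xs (dropLast 2).hasFDerivAt).const_mul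
      (1 / 2 : ℝ)
    refine (this.congr_of_eventuallyEq ?_)
    exact Eventually.of_forall fun x => by simp only [comp_apply]; ring
  have hsecond : HasFDerivAt
      (fun x : EuclideanSpace ℝ (Fin 4) => (N (dropLast 2 x) / 2) • ((fderiv ℝ N (dropLast 2 x)).comp (dropLast 2)))
      ((N z₀ / 2) • (Φ.comp ((fderiv ℝ (fderiv ℝ N) z₀).comp (dropLast 2)))) xs := by
    have := hcd.smul hGd
    rw [hxs, hN0, ContinuousLinearMap.zero_comp, ContinuousLinearMap.smulRight_zero, add_zero] at this
    exact this
  have hfirst : HasFDerivAt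
      (fun x : EuclideanSpace ℝ (Fin 4) => (x 3 / 2) • (EuclideanSpace.proj (3 : Fin 4) : EuclideanSpace ℝ (Fin 4) →L[ℝ] ℝ))
      (((1 / 2 : ℝ) • (EuclideanSpace.proj (3 : Fin 4) : EuclideanSpace ℝ (Fin 4) →L[ℝ] ℝ)).smulRight
        (EuclideanSpace.proj (3 : Fin 4) : EuclideanSpace ℝ (Fin 4) →L[ℝ] ℝ)) xs := by
    have h3 : HasFDerivAt (fun x : EuclideanSpace ℝ (Fin 4) => x 3 / 2)
        ((1 / 2 : ℝ) • (EuclideanSpace.proj (3 : Fin 4) : EuclideanSpace ℝ (Fin 4) →L[ℝ] ℝ)) xs := by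
      have := (EuclideanSpace.proj (3 : Fin 4) : EuclideanSpace ℝ (Fin 4) →L[ℝ] ℝ).hasFDerivAt.const_mul
        (1 / 2 : ℝ) (x := xs)
      refine this.congr_of_eventuallyEq (Eventually.of_forall fun x => ?_)
      show x 3 / 2 = 1 / 2 * x 3
      ring
    exact h3.smul_const (EuclideanSpace.proj (3 : Fin 4) : EuclideanSpace ℝ (Fin 4) →L[ℝ] ℝ)
  have hall : HasFDerivAt h'
      ((((1 / 2 : ℝ) • (EuclideanSpace.proj (3 : Fin 4) : EuclideanSpace ℝ (Fin 4) →L[ℝ] ℝ)).smulRight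
        (EuclideanSpace.proj (3 : Fin 4) : EuclideanSpace ℝ (Fin 4) →L[ℝ] ℝ)) -
        (N z₀ / 2) • (Φ.comp ((fderiv ℝ (fderiv ℝ N) z₀).comp (dropLast 2)))) xs :=
    hfirst.sub hsecond
  rw [hall.fderiv]
  simp only [sub_apply, smul_apply, ContinuousLinearMap.smulRight_apply, ContinuousLinearMap.comp_apply,
    hΦapply, smul_eq_mul]
  have e1 : (EuclideanSpace.proj (3 : Fin 4) : EuclideanSpace ℝ (Fin 4) →L[ℝ] ℝ) w = w 3 := rfl
  have e2 : (EuclideanSpace.proj (3 : Fin 4) : EuclideanSpace ℝ (Fin 4) →L[ℝ] ℝ) w' = w' 3 := rfl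
  rw [e1, e2]
  ring

/-- **The Hessian of `q` at `x⋆`** as a bilinear form:
`Hess q(x⋆)(w, w') = w₃ w'₃ / 2 - (N(z₀)/2) Hess N(z₀)(dl w, dl w')`. [cite: GayKirby2016, proof of Lemma 10] -/
theorem mhessian_q_xs (hNs : ContDiff ℝ ∞ N) (hMdef : ∀ z, M z = N z - z 0) (hP₀ : 0 < P₀)
    {z₀ z₁ : EuclideanSpace ℝ (Fin 3)} (hcrit : criticalSet (𝓡 3) N = {z₀, z₁})
    (hnN : ∀ x, nN x = x 0 + θR P₀ (x 3) * M (dropLast 2 x))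
    (hq : ∀ x, q x = (x 3 ^ 2 - nN x ^ 2) / 4)
    {xs : EuclideanSpace ℝ (Fin 4)} (hxs : dropLast 2 xs = z₀) (hxs3 : xs 3 = 0)
    (w w' : EuclideanSpace ℝ (Fin 4)) :
    mhessian (𝓡 4) q xs w w' =
      w 3 * w' 3 / 2 - (N z₀ / 2) * mhessian (𝓡 3) N z₀ (dropLast 2 w) (dropLast 2 w') := by
  rw [mhessian_model_apply, mhessian_model_apply]
  exact fderiv_fderiv_q_xs hNs hMdef hP₀ hcrit hnN hq hxs hxs3 w w'

/-- `n″` is smooth. [folklore] -/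
theorem contDiff_nN (hMs : ContDiff ℝ ∞ M)
    (hnN : ∀ x, nN x = x 0 + θR P₀ (x 3) * M (dropLast 2 x)) : ContDiff ℝ ∞ nN := by
  have hfun : nN = fun x => x 0 + θR P₀ (x 3) * M (dropLast 2 x) := funext hnN
  rw [hfun]
  refine ((EuclideanSpace.proj (0 : Fin 4) : EuclideanSpace ℝ (Fin 4) →L[ℝ] ℝ).contDiff).add
    ((θR_contDiff.comp (EuclideanSpace.proj (3 : Fin 4) : EuclideanSpace ℝ (Fin 4) →L[ℝ] ℝ).contDiff).mul
      (hMs.comp (dropLast 2).contDiff))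

/-- `q` is smooth. [folklore] -/
theorem contDiff_q (hMs : ContDiff ℝ ∞ M)
    (hnN : ∀ x, nN x = x 0 + θR P₀ (x 3) * M (dropLast 2 x))
    (hq : ∀ x, q x = (x 3 ^ 2 - nN x ^ 2) / 4) : ContDiff ℝ ∞ q := by
  have hfun : q = fun x => (x 3 ^ 2 - nN x ^ 2) / 4 := funext hq
  rw [hfun]
  exact (((EuclideanSpace.proj (3 : Fin 4) : EuclideanSpace ℝ (Fin 4) →L[ℝ] ℝ).contDiff.pow 2).sub
    ((contDiff_nN hMs hnN).pow 2)).div_const 4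

/-- `ũ`, `ṽ` are smooth. [folklore] -/
theorem contDiff_uN_vN (hMs : ContDiff ℝ ∞ M)
    (hnN : ∀ x, nN x = x 0 + θR P₀ (x 3) * M (dropLast 2 x))
    (huN : ∀ x, uN x = (x 3 - nN x) / 2) (hvN : ∀ x, vN x = (-x 3 - nN x) / 2) :
    ContDiff ℝ ∞ uN ∧ ContDiff ℝ ∞ vN := by
  have h3 := (EuclideanSpace.proj (3 : Fin 4) : EuclideanSpace ℝ (Fin 4) →L[ℝ] ℝ).contDiff (n := ∞)
  have hn := contDiff_nN hMs hnN
  have hfu : uN = fun x => (x 3 - nN x) / 2 := funext huN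
  have hfv : vN = fun x => (-x 3 - nN x) / 2 := funext hvN
  rw [hfu, hfv]
  exact ⟨(h3.sub hn).div_const 2, (h3.neg.sub hn).div_const 2⟩

open LinearMap.BilinForm in
/-- **The critical point `x⋆` of `q = -ũ ṽ` is nondegenerate of index `1`.**  Its Hessian
`w₃ w'₃ / 2 - (N(z₀)/2) Hess N(z₀)(dl w, dl w')` splits orthogonally over `ℝ⁴ = ℝ e₃ ⊕ {w₃ = 0}`
(`LinearMap.BilinForm.sigNeg_eq_of_line_ker`): a positive line plus the positive multiple
`-N(z₀)/2 > 0` of the Hessian of `N` at its critical point `z₀` of index `1`.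
[cite: GayKirby2016, proof of Lemma 10; Milnor1963, §2] -/
theorem morseData_q_xs (hN : IsMorse (𝓡 3) N) (hMdef : ∀ z, M z = N z - z 0) (hP₀ : 0 < P₀)
    {z₀ z₁ : EuclideanSpace ℝ (Fin 3)} (hcrit : criticalSet (𝓡 3) N = {z₀, z₁})
    (hi₀ : morseIndex (𝓡 3) N z₀ = 1) (hz₀ : N z₀ < 0)
    (hnN : ∀ x, nN x = x 0 + θR P₀ (x 3) * M (dropLast 2 x))
    (hq : ∀ x, q x = (x 3 ^ 2 - nN x ^ 2) / 4)
    {xs : EuclideanSpace ℝ (Fin 4)} (hxs : dropLast 2 xs = z₀) (hxs3 : xs 3 = 0) :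
    (mhessian (𝓡 4) q xs).Nondegenerate ∧ morseIndex (𝓡 4) q xs = 1 := by
  have hNs : ContDiff ℝ ∞ N := contMDiff_iff_contDiff.1 hN.1
  have hMs := contDiff_M hNs hMdef
  set B := mhessian (𝓡 4) q xs with hBdef
  set H := mhessian (𝓡 3) N z₀ with hHdef
  have hB : ∀ w w' : EuclideanSpace ℝ (Fin 4),
      B w w' = w 3 * w' 3 / 2 - (N z₀ / 2) * H (dropLast 2 w) (dropLast 2 w') :=
    mhessian_q_xs hNs hMdef hP₀ hcrit hnN hq hxs hxs3
  -- symmetry of the Hessian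
  have hq2 : ContMDiff (𝓡 4) 𝓘(ℝ, ℝ) 2 q :=
    contMDiff_iff_contDiff.2 ((contDiff_q hMs hnN hq).of_le (by norm_cast))
  have hBsymm : B.IsSymm := ⟨fun v w => (mhessian_isSymm_holds hq2 xs).eq v w⟩
  -- the splitting data
  set ξ : EuclideanSpace ℝ (Fin 4) := EuclideanSpace.single 3 1 with hξdef
  set ℓ : EuclideanSpace ℝ (Fin 4) →ₗ[ℝ] ℝ :=
    ((EuclideanSpace.proj (3 : Fin 4) : EuclideanSpace ℝ (Fin 4) →L[ℝ] ℝ) :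
      EuclideanSpace ℝ (Fin 4) →ₗ[ℝ] ℝ) with hℓdef
  have hℓapply : ∀ w : EuclideanSpace ℝ (Fin 4), ℓ w = w 3 := fun w => rfl
  have hξ3 : ξ 3 = 1 := by simp [hξdef]
  have hξ : ℓ ξ ≠ 0 := by rw [hℓapply, hξ3]; exact one_ne_zero
  have hdlξ : dropLast 2 ξ = 0 := dropLast_single_three
  have hcross : ∀ k ∈ LinearMap.ker ℓ, B ξ k = 0 ∧ B k ξ = 0 := by
    intro k hk
    have hk3 : k 3 = 0 := by rw [LinearMap.mem_ker, hℓapply] at hk; exact hk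
    constructor
    · rw [hB, hk3, hdlξ, LinearMap.map_zero₂]; ring
    · rw [hB, hk3, hdlξ, map_zero]; ring
  have hBξξ : B ξ ξ = 1 / 2 := by
    rw [hB, hξ3, hdlξ, map_zero]; ring
  -- the kernel of `ℓ` is `ℝ³`
  set L : LinearMap.ker ℓ ≃ₗ[ℝ] EuclideanSpace ℝ (Fin 3) :=
    { toFun := fun k => dropLast 2 (k : EuclideanSpace ℝ (Fin 4))
      invFun := fun ζ => ⟨snocEquiv 3 (ζ, 0), by
        rw [LinearMap.mem_ker, hℓapply]
        exact snocEquiv_apply_last 3 (ζ, 0)⟩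
      map_add' := fun k k' => by simp
      map_smul' := fun r k => by simp
      left_inv := fun k => by
        apply Subtype.ext
        show snocEquiv 3 (dropLast 2 (k : EuclideanSpace ℝ (Fin 4)), 0) = k
        exact snocEquiv_dropLast 2 (y := (k : EuclideanSpace ℝ (Fin 4)))
          (by have := k.2; rw [LinearMap.mem_ker, hℓapply] at this; exact this)
      right_inv := fun ζ => dropLast_snocEquiv 2 ζ 0 } with hLdef
  have hLapply : ∀ k : LinearMap.ker ℓ, L k = dropLast 2 (k : EuclideanSpace ℝ (Fin 4)) := fun k => rfl
  -- the restricted form is `(-N z₀ / 2) • H`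
  have hc : 0 < -(N z₀ / 2) := by linarith
  have hrestr : ∀ v w : LinearMap.ker ℓ,
      B.restrict (LinearMap.ker ℓ) v w = ((-(N z₀ / 2)) • H) (L v) (L w) := by
    intro v w
    have hv3 : (v : EuclideanSpace ℝ (Fin 4)) 3 = 0 := by
      have := v.2; rw [LinearMap.mem_ker, hℓapply] at this; exact this
    rw [LinearMap.BilinForm.restrict_apply, LinearMap.domRestrict_apply, hLapply, hLapply,
      LinearMap.smul_apply, LinearMap.smul_apply, hB, hv3]
    simp only [zero_mul, zero_div, zero_sub, smul_eq_mul]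
    ring
  have hz₀crit : IsMCriticalPt (𝓡 3) N z₀ := by
    rw [← mem_criticalSet (I := 𝓡 3), hcrit]; exact mem_insert _ _
  have hHnd : H.Nondegenerate := hN.nondegenerate hz₀crit
  refine ⟨?_, ?_⟩
  · rw [nondegenerate_iff_of_line_ker B hξ hcross]
    refine ⟨by rw [hBξξ]; norm_num, ?_⟩
    rw [nondegenerate_iff_of_forall_apply_eq L hrestr]
    exact (nondegenerate_smul_iff H hc.ne').2 hHnd
  · show sigNeg B.toQuadraticMap = 1
    rw [sigNeg_eq_of_line_ker B hBsymm hξ hcross, hBξξ, if_neg (by norm_num), zero_add,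
      sigNeg_eq_of_forall_apply_eq L hrestr, sigNeg_smul_of_pos' H hc]
    exact hi₀

/-! ### No critical points in the two other open wedges -/

/-- The derivative of `g = α x₃² + β x₃ n″`. [folklore] -/
theorem hasFDerivAt_gen (hMs : ContDiff ℝ ∞ M)
    (hnN : ∀ x, nN x = x 0 + θR P₀ (x 3) * M (dropLast 2 x)) {α β : ℝ} {g : EuclideanSpace ℝ (Fin 4) → ℝ}
    (hg : ∀ x, g x = α * x 3 ^ 2 + β * x 3 * nN x) (x : EuclideanSpace ℝ (Fin 4)) :
    HasFDerivAt g
      ((2 * α * x 3 + β * nN x) • (EuclideanSpace.proj (3 : Fin 4) : EuclideanSpace ℝ (Fin 4) →L[ℝ] ℝ) +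
        (β * x 3) • ((EuclideanSpace.proj (0 : Fin 4) : EuclideanSpace ℝ (Fin 4) →L[ℝ] ℝ) +
        (θR P₀ (x 3) • (fderiv ℝ M (dropLast 2 x)).comp (dropLast 2) +
          M (dropLast 2 x) • (deriv (θR P₀) (x 3) •
            (EuclideanSpace.proj (3 : Fin 4) : EuclideanSpace ℝ (Fin 4) →L[ℝ] ℝ))))) x := by
  have hfun : g = fun x => α * (x 3 * x 3) + β * (x 3 * nN x) := by
    funext x; rw [hg]; ring
  rw [hfun]
  have h3 : HasFDerivAt (fun x : EuclideanSpace ℝ (Fin 4) => x 3)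
      (EuclideanSpace.proj (3 : Fin 4) : EuclideanSpace ℝ (Fin 4) →L[ℝ] ℝ) x :=
    (EuclideanSpace.proj (3 : Fin 4) : EuclideanSpace ℝ (Fin 4) →L[ℝ] ℝ).hasFDerivAt
  have hn := hasFDerivAt_nN hMs hnN x
  have h := ((h3.mul h3).const_mul α).add ((h3.mul hn).const_mul β)
  refine h.congr_fderiv ?_
  ext w
  simp only [smul_apply, add_apply, smul_eq_mul]
  have e : (EuclideanSpace.proj (3 : Fin 4) : EuclideanSpace ℝ (Fin 4) →L[ℝ] ℝ) w = w 3 := rfl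
  rw [e]
  ring

/-- **The critical-point equations of `g = α x₃² + β x₃ n″`** on the basis vectors.
[cite: GayKirby2016, proof of Lemma 10] -/
theorem crit_equations_gen (hMs : ContDiff ℝ ∞ M)
    (hnN : ∀ x, nN x = x 0 + θR P₀ (x 3) * M (dropLast 2 x)) {α β : ℝ} {g : EuclideanSpace ℝ (Fin 4) → ℝ}
    (hg : ∀ x, g x = α * x 3 ^ 2 + β * x 3 * nN x) {x : EuclideanSpace ℝ (Fin 4)}
    (hx : fderiv ℝ g x = 0) :
    2 * α * x 3 + β * nN x + β * x 3 * (deriv (θR P₀) (x 3) * M (dropLast 2 x)) = 0 ∧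
    β * x 3 * (1 + θR P₀ (x 3) * fderiv ℝ M (dropLast 2 x) (EuclideanSpace.single 0 1)) = 0 ∧
    β * x 3 * (θR P₀ (x 3) * fderiv ℝ M (dropLast 2 x) (EuclideanSpace.single 1 1)) = 0 ∧
    β * x 3 * (θR P₀ (x 3) * fderiv ℝ M (dropLast 2 x) (EuclideanSpace.single 2 1)) = 0 := by
  set L : EuclideanSpace ℝ (Fin 4) →L[ℝ] ℝ :=
    (EuclideanSpace.proj (0 : Fin 4) : EuclideanSpace ℝ (Fin 4) →L[ℝ] ℝ) +
      (θR P₀ (x 3) • (fderiv ℝ M (dropLast 2 x)).comp (dropLast 2) +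
        M (dropLast 2 x) • (deriv (θR P₀) (x 3) •
          (EuclideanSpace.proj (3 : Fin 4) : EuclideanSpace ℝ (Fin 4) →L[ℝ] ℝ))) with hL
  have hd := (hasFDerivAt_gen hMs hnN hg x).fderiv
  rw [hx] at hd
  have happly : ∀ w : EuclideanSpace ℝ (Fin 4),
      (2 * α * x 3 + β * nN x) * w 3 + (β * x 3) * L w = 0 := by
    intro w
    have := congrArg (fun L : EuclideanSpace ℝ (Fin 4) →L[ℝ] ℝ => L w) hd
    simp only [zero_apply, add_apply, smul_apply, smul_eq_mul] at this
    have h3 : (EuclideanSpace.proj (3 : Fin 4) : EuclideanSpace ℝ (Fin 4) →L[ℝ] ℝ) w = w 3 := rfl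
    rw [h3] at this
    have hLw : L w = (EuclideanSpace.proj (0 : Fin 4) : EuclideanSpace ℝ (Fin 4) →L[ℝ] ℝ) w +
        (θR P₀ (x 3) * ((fderiv ℝ M (dropLast 2 x)).comp (dropLast 2)) w +
          M (dropLast 2 x) * (deriv (θR P₀) (x 3) * w 3)) := by
      simp only [hL, add_apply, smul_apply, smul_eq_mul, h3]
    rw [hLw]
    linarith
  simp only [hL] at happly
  have e3 := happly (EuclideanSpace.single 3 1)
  rw [nN'_single_three] at e3
  have s33 : (EuclideanSpace.single (3 : Fin 4) (1 : ℝ) : EuclideanSpace ℝ (Fin 4)) 3 = 1 := by simp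
  rw [s33] at e3
  have e0 := happly (EuclideanSpace.single (Fin.castSucc (0 : Fin 3)) 1)
  rw [nN'_single_castSucc] at e0
  have s03 : (EuclideanSpace.single (Fin.castSucc (0 : Fin 3)) (1 : ℝ) : EuclideanSpace ℝ (Fin 4)) 3 = 0 := by
    rw [EuclideanSpace.single, PiLp.single_apply, if_neg (by decide)]
  rw [s03, if_pos rfl] at e0
  have e1 := happly (EuclideanSpace.single (Fin.castSucc (1 : Fin 3)) 1)
  rw [nN'_single_castSucc] at e1
  have s13 : (EuclideanSpace.single (Fin.castSucc (1 : Fin 3)) (1 : ℝ) : EuclideanSpace ℝ (Fin 4)) 3 = 0 := by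
    rw [EuclideanSpace.single, PiLp.single_apply, if_neg (by decide)]
  rw [s13, if_neg (show (1 : Fin 3) ≠ 0 by decide)] at e1
  have e2 := happly (EuclideanSpace.single (Fin.castSucc (2 : Fin 3)) 1)
  rw [nN'_single_castSucc] at e2
  have s23 : (EuclideanSpace.single (Fin.castSucc (2 : Fin 3)) (1 : ℝ) : EuclideanSpace ℝ (Fin 4)) 3 = 0 := by
    rw [EuclideanSpace.single, PiLp.single_apply, if_neg (by decide)]
  rw [s23, if_neg (show (2 : Fin 3) ≠ 0 by decide)] at e2
  refine ⟨by linarith, by linarith, by linarith, by linarith⟩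

/-- **No critical points of the wedge functions in their open wedges — the common part.**  If
`fderiv g x = 0` for `g = α x₃² + β x₃ n″` with `β ≠ 0`, `x₃ ≠ 0`, then: `θ ≠ 0` (so
`|x₃| < 3P₀/2`), `z = dl x ∈ K` (so `|x₀| < r`), `|n″| < r + ε`; on the plateau `|x₃| < P₀`
moreover `∇N(z) = 0`, `n″ = N(z)` and `2α x₃ + β n″ = 0`; off the plateau
`|2α x₃ + β n″| ≤ |β| (3P₀/2) (C/P₀) ε`. [cite: GayKirby2016, proof of Lemma 10] -/
theorem crit_gen_consequences (hNs : ContDiff ℝ ∞ N) (hMdef : ∀ z, M z = N z - z 0)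
    {K : Set (EuclideanSpace ℝ (Fin 3))} (hK : IsClosed K) {x₀ : EuclideanSpace ℝ (Fin 3)} {r : ℝ}
    (hKball : K ⊆ ball x₀ r) (hx₀ : x₀ 0 = 0) (hNK : ∀ z ∉ K, N z = z 0)
    {ε : ℝ} (hε : ∀ z, |N z - z 0| < ε)
    {z₀ z₁ : EuclideanSpace ℝ (Fin 3)} (hcrit : criticalSet (𝓡 3) N = {z₀, z₁})
    (hP₀ : 0 < P₀) {C : ℝ} (hC : ∀ t, |deriv θ t| ≤ C)
    (hnN : ∀ x, nN x = x 0 + θR P₀ (x 3) * M (dropLast 2 x)) {α β : ℝ} (hβ : β ≠ 0)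
    {g : EuclideanSpace ℝ (Fin 4) → ℝ} (hg : ∀ x, g x = α * x 3 ^ 2 + β * x 3 * nN x)
    {x : EuclideanSpace ℝ (Fin 4)} (hx3 : x 3 ≠ 0) (hx : fderiv ℝ g x = 0) :
    |nN x| < r + ε ∧
    ((|x 3| < P₀ ∧ (dropLast 2 x = z₀ ∨ dropLast 2 x = z₁) ∧ nN x = N (dropLast 2 x) ∧
        2 * α * x 3 + β * nN x = 0) ∨
      (P₀ ≤ |x 3| ∧ |2 * α * x 3 + β * nN x| ≤ |β| * (3 / 2 * P₀) * (C / P₀) * ε)) := by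
  have hMs := contDiff_M hNs hMdef
  set z := dropLast 2 x with hz
  obtain ⟨e3, e0, e1, e2⟩ := crit_equations_gen hMs hnN hg hx
  have hβx : β * x 3 ≠ 0 := mul_ne_zero hβ hx3
  have e0' : 1 + θR P₀ (x 3) * fderiv ℝ M z (EuclideanSpace.single 0 1) = 0 :=
    (mul_eq_zero.1 e0).resolve_left hβx
  have e1' : θR P₀ (x 3) * fderiv ℝ M z (EuclideanSpace.single 1 1) = 0 :=
    (mul_eq_zero.1 e1).resolve_left hβx
  have e2' : θR P₀ (x 3) * fderiv ℝ M z (EuclideanSpace.single 2 1) = 0 :=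
    (mul_eq_zero.1 e2).resolve_left hβx
  have hθne : θR P₀ (x 3) ≠ 0 := by
    intro h0; rw [h0, zero_mul, add_zero] at e0'; exact one_ne_zero e0'
  have hM0ne : fderiv ℝ M z (EuclideanSpace.single 0 1) ≠ 0 := by
    intro h0; rw [h0, mul_zero, add_zero] at e0'; exact one_ne_zero e0'
  have hzK : z ∈ K := mem_of_fderiv_M_ne_zero hMdef hK hNK (fun h0 => hM0ne (by rw [h0]; rfl))
  have hz0 : |z 0| < r := abs_apply_zero_lt_of_mem hKball hx₀ hzK
  have hx0 : x 0 = z 0 := (dropLast_two_apply_zero x).symm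
  have hnNabs : |nN x| < r + ε := by
    rw [hnN, hx0]
    have h1 : |θR P₀ (x 3) * M z| ≤ |M z| := by
      rw [abs_mul]
      exact mul_le_of_le_one_left (abs_nonneg _) (abs_θR_le_one _)
    have h2 := abs_M_lt hMdef hε z
    calc |z 0 + θR P₀ (x 3) * M z| ≤ |z 0| + |θR P₀ (x 3) * M z| := abs_add_le _ _
      _ < r + ε := by linarith
  refine ⟨hnNabs, ?_⟩
  by_cases hplat : |x 3| < P₀
  · left
    have hθ1 : θR P₀ (x 3) = 1 := θR_eq_one hP₀ hplat.le
    have hθ'0 : deriv (θR P₀) (x 3) = 0 := deriv_θR_eq_zero hP₀ hplat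
    rw [hθ1, one_mul] at e0' e1' e2'
    have hN0 : fderiv ℝ N z = 0 := by
      apply clm_eq_zero_of_apply_single_three
      intro i
      have hi := fderiv_M_single hNs hMdef z i
      by_cases hi0 : i = 0
      · subst hi0
        rw [if_pos rfl] at hi
        linarith
      · rw [if_neg hi0, sub_zero] at hi
        have hMi : fderiv ℝ M z (EuclideanSpace.single i 1) = 0 := by
          fin_cases i
          · exact absurd rfl hi0
          · exact e1'
          · exact e2'
        rw [← hi, hMi]
    refine ⟨hplat, (fderiv_N_eq_zero_iff hcrit z).1 hN0, ?_, ?_⟩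
    · rw [hnN, hθ1, one_mul, hMdef, hx0]; ring
    · rw [hθ'0] at e3; linarith
  · right
    rw [not_lt] at hplat
    refine ⟨hplat, ?_⟩
    have hx3lt : |x 3| < 3 / 2 * P₀ := abs_lt_of_θR_ne_zero hP₀ hθne
    have hCP : |deriv (θR P₀) (x 3)| ≤ C / P₀ := abs_deriv_θR_le hP₀ hC _
    have hC0 : 0 ≤ C := le_trans (abs_nonneg _) (hC 0)
    have hMz := abs_M_lt hMdef hε z
    have heq : 2 * α * x 3 + β * nN x = -(β * x 3 * (deriv (θR P₀) (x 3) * M z)) := by linarith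
    rw [heq, abs_neg, abs_mul, abs_mul, abs_mul]
    have h1 : |x 3| * (|deriv (θR P₀) (x 3)| * |M z|) ≤ (3 / 2 * P₀) * ((C / P₀) * ε) :=
      mul_le_mul hx3lt.le (mul_le_mul hCP hMz.le (abs_nonneg _) (div_nonneg hC0 hP₀.le))
        (by positivity) (by positivity)
    calc |β| * |x 3| * (|deriv (θR P₀) (x 3)| * |M z|)
        = |β| * (|x 3| * (|deriv (θR P₀) (x 3)| * |M z|)) := by ring
      _ ≤ |β| * ((3 / 2 * P₀) * ((C / P₀) * ε)) := mul_le_mul_of_nonneg_left h1 (abs_nonneg _)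
      _ = |β| * (3 / 2 * P₀) * (C / P₀) * ε := by ring

/-- **Sector `j`: no critical points of `q_j = x₃ (n″ - x₃)/2 = -ũ_j ṽ_j` in the open wedge
`{x₃ < 0, n″ > x₃}`** (under `r + ε + (3/2) C ε < 2P₀`).  On the plateau the equations force
`n″ = 2x₃` and `∇N = 0`, so `n″ = N(z) > 0` (as `n″ > x₃ = n″/2`), `z = z₁`, `x₃ = N(z₁)/2 > 0`;
off the plateau `|n″ - 2x₃| ≤ (3/2) C ε` while `|n″ - 2x₃| ≥ 2P₀ - (r + ε)`.
[cite: GayKirby2016, proof of Lemma 10] -/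
theorem no_crit_j (hNs : ContDiff ℝ ∞ N) (hMdef : ∀ z, M z = N z - z 0)
    {K : Set (EuclideanSpace ℝ (Fin 3))} (hK : IsClosed K) {x₀ : EuclideanSpace ℝ (Fin 3)} {r : ℝ}
    (hKball : K ⊆ ball x₀ r) (hx₀ : x₀ 0 = 0) (hNK : ∀ z ∉ K, N z = z 0)
    {ε : ℝ} (hε : ∀ z, |N z - z 0| < ε)
    {z₀ z₁ : EuclideanSpace ℝ (Fin 3)} (hcrit : criticalSet (𝓡 3) N = {z₀, z₁})
    (hz₁ : 0 < N z₁)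
    (hP₀ : 0 < P₀) {C : ℝ} (hC : ∀ t, |deriv θ t| ≤ C) (hpar : r + ε + 3 / 2 * C * ε < 2 * P₀)
    (hnN : ∀ x, nN x = x 0 + θR P₀ (x 3) * M (dropLast 2 x))
    {g : EuclideanSpace ℝ (Fin 4) → ℝ} (hg : ∀ x, g x = x 3 * (nN x - x 3) / 2)
    {x : EuclideanSpace ℝ (Fin 4)} (hx3 : x 3 < 0) (hwedge : x 3 < nN x) : fderiv ℝ g x ≠ 0 := by
  intro hx
  have hg' : ∀ x, g x = (-(1 / 2 : ℝ)) * x 3 ^ 2 + (1 / 2 : ℝ) * x 3 * nN x := fun x => by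
    rw [hg]; ring
  obtain ⟨hnNabs, hcase⟩ := crit_gen_consequences hNs hMdef hK hKball hx₀ hNK hε hcrit hP₀ hC hnN
    (by norm_num) hg' hx3.ne hx
  rcases hcase with ⟨-, hzc, hval, hlin⟩ | ⟨hplat, hbd⟩
  · -- plateau: `nN = 2 x3`, then `N z > 0`, `z = z₁`, `x3 > 0`
    have hnN2 : nN x = 2 * x 3 := by linarith
    have hNpos : 0 < N (dropLast 2 x) := by rw [← hval]; linarith
    rcases hzc with h | h
    · rw [h] at hNpos; linarith
    · rw [h] at hval; linarith
  · have h1 : |2 * (-(1 / 2 : ℝ)) * x 3 + 1 / 2 * nN x| ≤ |(1 / 2 : ℝ)| * (3 / 2 * P₀) * (C / P₀) * ε := hbd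
    rw [abs_of_pos (by norm_num : (0 : ℝ) < 1 / 2)] at h1
    have h2 : (1 / 2 : ℝ) * (3 / 2 * P₀) * (C / P₀) * ε = 3 / 4 * C * ε := by
      field_simp
      ring
    rw [h2] at h1
    have h3 : |2 * (-(1 / 2 : ℝ)) * x 3 + 1 / 2 * nN x| = |nN x - 2 * x 3| / 2 := by
      rw [show 2 * (-(1 / 2 : ℝ)) * x 3 + 1 / 2 * nN x = (nN x - 2 * x 3) / 2 by ring, abs_div,
        abs_two]
    rw [h3] at h1
    have h4 : 2 * P₀ - (r + ε) ≤ |nN x - 2 * x 3| := by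
      have := abs_sub_abs_le_abs_sub (2 * x 3) (nN x)
      rw [abs_sub_comm] at this
      rw [abs_mul, abs_two] at this
      have hx3abs : P₀ ≤ |x 3| := hplat
      linarith [hnNabs.le]
    linarith

/-- **Sector `l`: no critical points of `q_l = -x₃ (x₃ + n″)/2 = -ũ_l ṽ_l` in the open wedge
`{x₃ > 0, x₃ + n″ > 0}`** (under `r + ε + (3/2) C ε < 2P₀`); symmetric to `no_crit_j`.
[cite: GayKirby2016, proof of Lemma 10] -/
theorem no_crit_l (hNs : ContDiff ℝ ∞ N) (hMdef : ∀ z, M z = N z - z 0)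
    {K : Set (EuclideanSpace ℝ (Fin 3))} (hK : IsClosed K) {x₀ : EuclideanSpace ℝ (Fin 3)} {r : ℝ}
    (hKball : K ⊆ ball x₀ r) (hx₀ : x₀ 0 = 0) (hNK : ∀ z ∉ K, N z = z 0)
    {ε : ℝ} (hε : ∀ z, |N z - z 0| < ε)
    {z₀ z₁ : EuclideanSpace ℝ (Fin 3)} (hcrit : criticalSet (𝓡 3) N = {z₀, z₁})
    (hz₁ : 0 < N z₁)
    (hP₀ : 0 < P₀) {C : ℝ} (hC : ∀ t, |deriv θ t| ≤ C) (hpar : r + ε + 3 / 2 * C * ε < 2 * P₀)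
    (hnN : ∀ x, nN x = x 0 + θR P₀ (x 3) * M (dropLast 2 x))
    {g : EuclideanSpace ℝ (Fin 4) → ℝ} (hg : ∀ x, g x = -(x 3 * (x 3 + nN x)) / 2)
    {x : EuclideanSpace ℝ (Fin 4)} (hx3 : 0 < x 3) (hwedge : 0 < x 3 + nN x) : fderiv ℝ g x ≠ 0 := by
  intro hx
  have hg' : ∀ x, g x = (-(1 / 2 : ℝ)) * x 3 ^ 2 + (-(1 / 2 : ℝ)) * x 3 * nN x := fun x => by
    rw [hg]; ring
  obtain ⟨hnNabs, hcase⟩ := crit_gen_consequences hNs hMdef hK hKball hx₀ hNK hε hcrit hP₀ hC hnN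
    (by norm_num) hg' hx3.ne' hx
  rcases hcase with ⟨-, hzc, hval, hlin⟩ | ⟨hplat, hbd⟩
  · have hnN2 : nN x = -(2 * x 3) := by linarith
    have hNneg : 0 < N (dropLast 2 x) := by rw [← hval]; linarith
    rcases hzc with h | h
    · rw [h] at hNneg; linarith
    · rw [h] at hval; linarith
  · have h1 : |2 * (-(1 / 2 : ℝ)) * x 3 + -(1 / 2) * nN x| ≤ |(-(1 / 2 : ℝ))| * (3 / 2 * P₀) * (C / P₀) * ε :=
      hbd
    rw [abs_neg, abs_of_pos (by norm_num : (0 : ℝ) < 1 / 2)] at h1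
    have h2 : (1 / 2 : ℝ) * (3 / 2 * P₀) * (C / P₀) * ε = 3 / 4 * C * ε := by
      field_simp
      ring
    rw [h2] at h1
    have h3 : |2 * (-(1 / 2 : ℝ)) * x 3 + -(1 / 2) * nN x| = |nN x + 2 * x 3| / 2 := by
      rw [show 2 * (-(1 / 2 : ℝ)) * x 3 + -(1 / 2) * nN x = -((nN x + 2 * x 3) / 2) by ring, abs_neg,
        abs_div, abs_two]
    rw [h3] at h1
    have h4 : 2 * P₀ - (r + ε) ≤ |nN x + 2 * x 3| := by
      have := abs_sub_abs_le_abs_sub (2 * x 3) (-nN x)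
      rw [show 2 * x 3 - -nN x = nN x + 2 * x 3 by ring, abs_neg, abs_mul, abs_two] at this
      have hx3abs : P₀ ≤ |x 3| := hplat
      linarith [hnNabs.le]
    linarith

/-! ### Regularity of `ũ`, `ṽ` everywhere -/

/-- **`∂₃ ũ > 0` and `∂₃ ṽ < 0` everywhere** (so `dũ`, `dṽ` vanish nowhere): along `e₃`,
`∂₃ ũ = (1 - θ' M)/2`, `∂₃ ṽ = (-1 - θ' M)/2` with `|θ' M| ≤ (C/P₀) ε < 1`.
[cite: GayKirby2016, proof of Lemma 10] -/
theorem fderiv_uN_vN_single_three (hNs : ContDiff ℝ ∞ N) (hMdef : ∀ z, M z = N z - z 0)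
    {ε : ℝ} (hε : ∀ z, |N z - z 0| < ε)
    (hP₀ : 0 < P₀) {C : ℝ} (hC : ∀ t, |deriv θ t| ≤ C) (hpar : C * ε < P₀)
    (hnN : ∀ x, nN x = x 0 + θR P₀ (x 3) * M (dropLast 2 x))
    (huN : ∀ x, uN x = (x 3 - nN x) / 2) (hvN : ∀ x, vN x = (-x 3 - nN x) / 2)
    (x : EuclideanSpace ℝ (Fin 4)) :
    0 < fderiv ℝ uN x (EuclideanSpace.single 3 1) ∧ fderiv ℝ vN x (EuclideanSpace.single 3 1) < 0 := by
  have hMs := contDiff_M hNs hMdef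
  have hn := hasFDerivAt_nN hMs hnN x
  have h3 : HasFDerivAt (fun x : EuclideanSpace ℝ (Fin 4) => x 3)
      (EuclideanSpace.proj (3 : Fin 4) : EuclideanSpace ℝ (Fin 4) →L[ℝ] ℝ) x :=
    (EuclideanSpace.proj (3 : Fin 4) : EuclideanSpace ℝ (Fin 4) →L[ℝ] ℝ).hasFDerivAt
  have hfu : uN = fun x => (1 / 2 : ℝ) * (x 3 - nN x) := by funext x; rw [huN]; ring
  have hfv : vN = fun x => (1 / 2 : ℝ) * (-x 3 - nN x) := by funext x; rw [hvN]; ring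
  have hdu0 := ((h3.sub hn).const_mul (1 / 2 : ℝ)).fderiv
  have hdv0 := ((h3.neg.sub hn).const_mul (1 / 2 : ℝ)).fderiv
  have hdu : fderiv ℝ uN x = (1 / 2 : ℝ) • ((EuclideanSpace.proj (3 : Fin 4) : EuclideanSpace ℝ (Fin 4) →L[ℝ] ℝ) -
      ((EuclideanSpace.proj (0 : Fin 4) : EuclideanSpace ℝ (Fin 4) →L[ℝ] ℝ) +
        (θR P₀ (x 3) • (fderiv ℝ M (dropLast 2 x)).comp (dropLast 2) +
          M (dropLast 2 x) • (deriv (θR P₀) (x 3) •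
            (EuclideanSpace.proj (3 : Fin 4) : EuclideanSpace ℝ (Fin 4) →L[ℝ] ℝ))))) := by
    rw [hfu]; exact hdu0
  have hdv : fderiv ℝ vN x = (1 / 2 : ℝ) • (-(EuclideanSpace.proj (3 : Fin 4) : EuclideanSpace ℝ (Fin 4) →L[ℝ] ℝ) -
      ((EuclideanSpace.proj (0 : Fin 4) : EuclideanSpace ℝ (Fin 4) →L[ℝ] ℝ) +
        (θR P₀ (x 3) • (fderiv ℝ M (dropLast 2 x)).comp (dropLast 2) +
          M (dropLast 2 x) • (deriv (θR P₀) (x 3) •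
            (EuclideanSpace.proj (3 : Fin 4) : EuclideanSpace ℝ (Fin 4) →L[ℝ] ℝ))))) := by
    rw [hfv]; exact hdv0
  rw [hdu, hdv]
  simp only [smul_apply, sub_apply, neg_apply, smul_eq_mul, nN'_single_three]
  have e3 : (EuclideanSpace.proj (3 : Fin 4) : EuclideanSpace ℝ (Fin 4) →L[ℝ] ℝ)
      (EuclideanSpace.single 3 1) = 1 := by simp
  rw [e3]
  -- the bound `|θ' M| < 1`
  have hCP : |deriv (θR P₀) (x 3)| ≤ C / P₀ := abs_deriv_θR_le hP₀ hC _
  have hC0 : 0 ≤ C := le_trans (abs_nonneg _) (hC 0)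
  have hMz := abs_M_lt hMdef hε (dropLast 2 x)
  have hprod : |deriv (θR P₀) (x 3) * M (dropLast 2 x)| < 1 := by
    rw [abs_mul]
    have h1 : |deriv (θR P₀) (x 3)| * |M (dropLast 2 x)| ≤ C / P₀ * ε := by
      rcases (abs_nonneg (deriv (θR P₀) (x 3))).lt_or_eq with hpos | hzero
      · exact mul_le_mul hCP hMz.le (abs_nonneg _) (div_nonneg hC0 hP₀.le)
      · rw [← hzero, zero_mul]; exact mul_nonneg (div_nonneg hC0 hP₀.le)
          (le_trans (abs_nonneg _) hMz.le)
    have h2 : C / P₀ * ε < 1 := by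
      rw [div_mul_eq_mul_div, div_lt_one hP₀]; exact hpar
    linarith
  have hb := abs_lt.1 hprod
  constructor
  · nlinarith [hb.1, hb.2]
  · nlinarith [hb.1, hb.2]

/-! ### The box carrying the modification -/

/-- `‖y‖² = ‖dl y‖² + y₃²` on `ℝ⁴`. [folklore] -/
theorem norm_sq_eq_dropLast (y : EuclideanSpace ℝ (Fin 4)) : ‖y‖ ^ 2 = ‖dropLast 2 y‖ ^ 2 + y 3 ^ 2 := by
  rw [EuclideanSpace.norm_sq_eq, EuclideanSpace.norm_sq_eq, Fin.sum_univ_castSucc]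
  simp only [Real.norm_eq_abs, sq_abs, dropLast_apply_coord]
  rfl

/-- `dl (y - y') = dl y - dl y'`. [folklore] -/
theorem dropLast_sub (y y' : EuclideanSpace ℝ (Fin 4)) : dropLast 2 (y - y') = dropLast 2 y - dropLast 2 y' :=
  map_sub _ _ _

/-- **Outside the box `{|x₃| ≤ 3P₀/2} ∩ dl⁻¹ K` the modification is trivial**: `n″ = x₀`, so
`ũ = (x₃ - x₀)/2`, `ṽ = (-x₃ - x₀)/2` are the unmodified normal coordinates. [folklore] -/
theorem uN_vN_eq_of_not_mem (hMdef : ∀ z, M z = N z - z 0) {K : Set (EuclideanSpace ℝ (Fin 3))}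
    (hNK : ∀ z ∉ K, N z = z 0) (hP₀ : 0 < P₀)
    (hnN : ∀ x, nN x = x 0 + θR P₀ (x 3) * M (dropLast 2 x))
    (huN : ∀ x, uN x = (x 3 - nN x) / 2) (hvN : ∀ x, vN x = (-x 3 - nN x) / 2)
    {x : EuclideanSpace ℝ (Fin 4)}
    (hx : x ∉ {y : EuclideanSpace ℝ (Fin 4) | |y 3| ≤ 3 / 2 * P₀ ∧ dropLast 2 y ∈ K}) :
    uN x = (x 3 - x 0) / 2 ∧ vN x = (-x 3 - x 0) / 2 := by
  have hnNx : nN x = x 0 := by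
    rw [hnN]
    simp only [mem_setOf_eq, not_and_or, not_le] at hx
    rcases hx with h | h
    · rw [θR_eq_zero hP₀ h.le]; ring
    · rw [M_eq_zero_of_not_mem hMdef hNK h]; ring
  rw [huN, hvN, hnNx]
  exact ⟨rfl, rfl⟩

/-- **The box is compact and lies in the ball `B(q⋆, R)`** when `K ⊆ B(dl q⋆, r)`, `q⋆₃ = 0`
and `r² + (3P₀/2)² < R²`. [folklore] -/
theorem isCompact_box {K : Set (EuclideanSpace ℝ (Fin 3))} (hK : IsCompact K)
    {qs : EuclideanSpace ℝ (Fin 4)} (hqs3 : qs 3 = 0) {r R : ℝ} (hKball : K ⊆ ball (dropLast 2 qs) r)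
    (hrR : r ^ 2 + (3 / 2 * P₀) ^ 2 < R ^ 2) (hR : 0 < R) :
    IsCompact {y : EuclideanSpace ℝ (Fin 4) | |y 3| ≤ 3 / 2 * P₀ ∧ dropLast 2 y ∈ K} ∧
      {y : EuclideanSpace ℝ (Fin 4) | |y 3| ≤ 3 / 2 * P₀ ∧ dropLast 2 y ∈ K} ⊆ ball qs R := by
  have hsub : {y : EuclideanSpace ℝ (Fin 4) | |y 3| ≤ 3 / 2 * P₀ ∧ dropLast 2 y ∈ K} ⊆ ball qs R := by
    rintro y ⟨hy3, hyK⟩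
    rw [mem_ball, dist_eq_norm]
    have h1 : dist (dropLast 2 y) (dropLast 2 qs) < r := hKball hyK
    rw [dist_eq_norm, ← dropLast_sub] at h1
    have hr : 0 < r := lt_of_le_of_lt dist_nonneg (hKball hyK)
    have h2 := norm_sq_eq_dropLast (y - qs)
    rw [PiLp.sub_apply, hqs3, sub_zero] at h2
    have h3 : ‖dropLast 2 (y - qs)‖ ^ 2 < r ^ 2 := by
      exact pow_lt_pow_left₀ h1 (norm_nonneg _) two_ne_zero
    have h4 : y 3 ^ 2 ≤ (3 / 2 * P₀) ^ 2 := by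
      rw [← sq_abs]; exact pow_le_pow_left₀ (abs_nonneg _) hy3 2
    have h5 : ‖y - qs‖ ^ 2 < R ^ 2 := by linarith
    exact lt_of_pow_lt_pow_left₀ 2 hR.le h5
  refine ⟨?_, hsub⟩
  apply Metric.isCompact_of_isClosed_isBounded
  · apply IsClosed.inter
    · exact isClosed_le (continuous_abs.comp (continuous_apply 3 |>.comp (PiLp.continuous_ofLp 2 _)))
        continuous_const
    · exact hK.isClosed.preimage (dropLast 2).continuous
  · exact (Metric.isBounded_ball (x := qs) (r := R)).subset hsub

/-! ### Adapted charts at the points of the new corner locus `{ũ = ṽ = 0}` -/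

/-- **A local diffeomorphism of `ℝ⁴` with first two coordinates `ũ, ṽ`**, at a point where
`w ↦ (dũ w, dṽ w, w_a, w_b)` is injective (inverse function theorem). [folklore] -/
theorem exists_localDiffeomorph_of_injective (huNs : ContDiff ℝ ∞ uN) (hvNs : ContDiff ℝ ∞ vN)
    (a b : Fin 4) {x : EuclideanSpace ℝ (Fin 4)}
    (hinj : ∀ w : EuclideanSpace ℝ (Fin 4), fderiv ℝ uN x w = 0 → fderiv ℝ vN x w = 0 →
      w a = 0 → w b = 0 → w = 0) :
    ∃ Ψ : OpenPartialHomeomorph (EuclideanSpace ℝ (Fin 4)) (EuclideanSpace ℝ (Fin 4)),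
      x ∈ Ψ.source ∧ ContDiffOn ℝ ∞ Ψ Ψ.source ∧ ContDiffOn ℝ ∞ Ψ.symm Ψ.target ∧
      ∀ y ∈ Ψ.source, Ψ y 0 = uN y ∧ Ψ y 1 = vN y := by
  set e0 : EuclideanSpace ℝ (Fin 4) := EuclideanSpace.single 0 (1:ℝ) with he0
  set e1 : EuclideanSpace ℝ (Fin 4) := EuclideanSpace.single 1 (1:ℝ) with he1
  set e2 : EuclideanSpace ℝ (Fin 4) := EuclideanSpace.single 2 (1:ℝ) with he2
  set e3 : EuclideanSpace ℝ (Fin 4) := EuclideanSpace.single 3 (1:ℝ) with he3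
  -- the map
  set Θ : EuclideanSpace ℝ (Fin 4) → EuclideanSpace ℝ (Fin 4) := fun y =>
    uN y • e0 + vN y • e1 + y a • e2 + y b • e3 with hΘ
  have hΘapply : ∀ y, Θ y = uN y • e0 + vN y • e1 + y a • e2 + y b • e3 := fun y => rfl
  have hΘ0 : ∀ y, Θ y 0 = uN y := fun y => by simp [hΘapply, he0, he1, he2, he3]
  have hΘ1 : ∀ y, Θ y 1 = vN y := fun y => by simp [hΘapply, he0, he1, he2, he3]
  have ha : ContDiff ℝ ∞ fun y : EuclideanSpace ℝ (Fin 4) => y a :=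
    (EuclideanSpace.proj a : EuclideanSpace ℝ (Fin 4) →L[ℝ] ℝ).contDiff
  have hb : ContDiff ℝ ∞ fun y : EuclideanSpace ℝ (Fin 4) => y b :=
    (EuclideanSpace.proj b : EuclideanSpace ℝ (Fin 4) →L[ℝ] ℝ).contDiff
  have hΘs : ContDiff ℝ ∞ Θ :=
    (((huNs.smul contDiff_const).add (hvNs.smul contDiff_const)).add (ha.smul contDiff_const)).add
      (hb.smul contDiff_const)
  -- its derivative at `x`
  set D : EuclideanSpace ℝ (Fin 4) →L[ℝ] EuclideanSpace ℝ (Fin 4) :=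
    (fderiv ℝ uN x).smulRight e0 + (fderiv ℝ vN x).smulRight e1 +
      (EuclideanSpace.proj a : EuclideanSpace ℝ (Fin 4) →L[ℝ] ℝ).smulRight e2 +
      (EuclideanSpace.proj b : EuclideanSpace ℝ (Fin 4) →L[ℝ] ℝ).smulRight e3 with hD
  have hΘd : HasFDerivAt Θ D x := by
    have hu := ((huNs.differentiable (by simp)) x).hasFDerivAt.smul_const e0
    have hv := ((hvNs.differentiable (by simp)) x).hasFDerivAt.smul_const e1
    have hpa := (EuclideanSpace.proj a : EuclideanSpace ℝ (Fin 4) →L[ℝ] ℝ).hasFDerivAt.smul_const e2 (x := x)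
    have hpb := (EuclideanSpace.proj b : EuclideanSpace ℝ (Fin 4) →L[ℝ] ℝ).hasFDerivAt.smul_const e3 (x := x)
    exact ((hu.add hv).add hpa).add hpb
  have hDapply : ∀ w, D w = fderiv ℝ uN x w • e0 + fderiv ℝ vN x w • e1 + w a • e2 + w b • e3 := by
    intro w; simp [hD]
  have hDker : ∀ w, D w = 0 → w = 0 := by
    intro w hw'
    rw [hDapply] at hw'
    have c0 := congrArg (fun u : EuclideanSpace ℝ (Fin 4) => u 0) hw'
    have c1 := congrArg (fun u : EuclideanSpace ℝ (Fin 4) => u 1) hw'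
    have c2 := congrArg (fun u : EuclideanSpace ℝ (Fin 4) => u 2) hw'
    have c3 := congrArg (fun u : EuclideanSpace ℝ (Fin 4) => u 3) hw'
    simp [he0, he1, he2, he3] at c0 c1 c2 c3
    exact hinj w c0 c1 c2 c3
  have hDinj : Injective D := by
    intro v w hvw
    have h0 : D (v - w) = 0 := by rw [map_sub, hvw, sub_self]
    exact sub_eq_zero.1 (hDker _ h0)
  set E : EuclideanSpace ℝ (Fin 4) ≃L[ℝ] EuclideanSpace ℝ (Fin 4) :=
    LinearEquiv.toContinuousLinearEquiv (LinearEquiv.ofInjectiveEndo D.toLinearMap hDinj) with hE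
  have hEcoe : (E : EuclideanSpace ℝ (Fin 4) →L[ℝ] EuclideanSpace ℝ (Fin 4)) = D := by
    ext v k; rfl
  have hΘdE : HasFDerivAt Θ (E : EuclideanSpace ℝ (Fin 4) →L[ℝ] EuclideanSpace ℝ (Fin 4)) x := by
    rw [hEcoe]; exact hΘd
  -- ### the inverse function theorem
  have hΘat : ContDiffAt ℝ ∞ Θ x := hΘs.contDiffAt
  set Φ₀ := hΘat.toOpenPartialHomeomorph Θ hΘdE (by simp) with hΦ₀
  have hΦ₀src : x ∈ Φ₀.source := hΘat.mem_toOpenPartialHomeomorph_source hΘdE (by simp)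
  have hΦ₀coe : (Φ₀ : EuclideanSpace ℝ (Fin 4) → EuclideanSpace ℝ (Fin 4)) = Θ := rfl
  -- invertibility of the derivative near `x`
  set U₁ : Set (EuclideanSpace ℝ (Fin 4)) := {q | fderiv ℝ Θ q ∈ range ((↑) :
    (EuclideanSpace ℝ (Fin 4) ≃L[ℝ] EuclideanSpace ℝ (Fin 4)) →
      EuclideanSpace ℝ (Fin 4) →L[ℝ] EuclideanSpace ℝ (Fin 4))} with hU₁
  have hU₁open : IsOpen U₁ :=
    (ContinuousLinearEquiv.isOpen).preimage (hΘs.continuous_fderiv (by simp))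
  have hU₁x : x ∈ U₁ := ⟨E, hΘdE.fderiv.symm⟩
  set Ψ := Φ₀.restrOpen U₁ hU₁open with hΨ
  have hΨcoe : (Ψ : EuclideanSpace ℝ (Fin 4) → EuclideanSpace ℝ (Fin 4)) = Θ := rfl
  have hΨsrc : Ψ.source = Φ₀.source ∩ U₁ := by rw [hΨ, OpenPartialHomeomorph.restrOpen_source]
  refine ⟨Ψ, by rw [hΨsrc]; exact ⟨hΦ₀src, hU₁x⟩, by rw [hΨcoe]; exact hΘs.contDiffOn, ?_,
    fun y _ => ⟨by rw [hΨcoe, hΘ0], by rw [hΨcoe, hΘ1]⟩⟩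
  intro z hz
  have hq : Ψ.symm z ∈ Ψ.source := Ψ.map_target hz
  have hqU : Ψ.symm z ∈ U₁ := by rw [hΨsrc] at hq; exact hq.2
  obtain ⟨Eq, hEq⟩ := hqU
  have hd : HasFDerivAt Ψ (Eq : EuclideanSpace ℝ (Fin 4) →L[ℝ] EuclideanSpace ℝ (Fin 4)) (Ψ.symm z) := by
    rw [hEq, hΨcoe]
    exact (hΘs.differentiable (by simp) _).hasFDerivAt
  exact (Ψ.contDiffAt_symm hz hd (by rw [hΨcoe]; exact hΘs.contDiffAt)).contDiffWithinAt

/-- **Adapted charts along the new corner locus.**  At a point with `ũ = ṽ = 0` (so `x₃ = 0`,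
`N(z) = 0`, hence `∇N(z) ≠ 0`) there is a local diffeomorphism of `ℝ⁴` whose first two
coordinates are `ũ, ṽ`: complete `(ũ, ṽ)` by the two coordinates of `z` other than one along
which `∂N ≠ 0`. [cite: GayKirby2016, proof of Lemma 10] -/
theorem exists_adaptedChart (hNs : ContDiff ℝ ∞ N) (hMdef : ∀ z, M z = N z - z 0)
    {z₀ z₁ : EuclideanSpace ℝ (Fin 3)} (hcrit : criticalSet (𝓡 3) N = {z₀, z₁})
    (hz₀ : N z₀ < 0) (hz₁ : 0 < N z₁) (hP₀ : 0 < P₀)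
    (hnN : ∀ x, nN x = x 0 + θR P₀ (x 3) * M (dropLast 2 x))
    (huN : ∀ x, uN x = (x 3 - nN x) / 2) (hvN : ∀ x, vN x = (-x 3 - nN x) / 2)
    {x : EuclideanSpace ℝ (Fin 4)} (hu0 : uN x = 0) (hv0 : vN x = 0) :
    ∃ Ψ : OpenPartialHomeomorph (EuclideanSpace ℝ (Fin 4)) (EuclideanSpace ℝ (Fin 4)),
      x ∈ Ψ.source ∧ ContDiffOn ℝ ∞ Ψ Ψ.source ∧ ContDiffOn ℝ ∞ Ψ.symm Ψ.target ∧
      ∀ y ∈ Ψ.source, Ψ y 0 = uN y ∧ Ψ y 1 = vN y := by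
  have hMs := contDiff_M hNs hMdef
  obtain ⟨huNs, hvNs⟩ := contDiff_uN_vN hMs hnN huN hvN
  set z := dropLast 2 x with hz
  have hx3 : x 3 = 0 := by have := (uN_sub_vN huN hvN x).1; rw [hu0, hv0, sub_self] at this; exact this.symm
  have hnN0 : nN x = 0 := by have := (uN_sub_vN huN hvN x).2; rw [hu0, hv0, add_zero] at this; linarith
  have hx0 : x 0 = z 0 := (dropLast_two_apply_zero x).symm
  have hNz : N z = 0 := by
    have : nN x = N z := by rw [hnN, hx3, θR_zero, one_mul, hMdef, hx0]; ring
    rw [← this, hnN0]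
  have hdN : fderiv ℝ N z ≠ 0 := by
    intro h0
    rcases (fderiv_N_eq_zero_iff hcrit z).1 h0 with h | h
    · rw [h] at hNz; linarith
    · rw [h] at hNz; linarith
  -- the derivatives of `ũ ± ṽ`
  have hn := hasFDerivAt_nN hMs hnN x
  have h3 : HasFDerivAt (fun x : EuclideanSpace ℝ (Fin 4) => x 3)
      (EuclideanSpace.proj (3 : Fin 4) : EuclideanSpace ℝ (Fin 4) →L[ℝ] ℝ) x :=
    (EuclideanSpace.proj (3 : Fin 4) : EuclideanSpace ℝ (Fin 4) →L[ℝ] ℝ).hasFDerivAt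
  have hfu : uN = fun x => (1 / 2 : ℝ) * (x 3 - nN x) := by funext y; rw [huN]; ring
  have hfv : vN = fun x => (1 / 2 : ℝ) * (-x 3 - nN x) := by funext y; rw [hvN]; ring
  have hdu : fderiv ℝ uN x = (1 / 2 : ℝ) • ((EuclideanSpace.proj (3 : Fin 4) : EuclideanSpace ℝ (Fin 4) →L[ℝ] ℝ) -
      ((EuclideanSpace.proj (0 : Fin 4) : EuclideanSpace ℝ (Fin 4) →L[ℝ] ℝ) +
        (θR P₀ (x 3) • (fderiv ℝ M (dropLast 2 x)).comp (dropLast 2) +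
          M (dropLast 2 x) • (deriv (θR P₀) (x 3) •
            (EuclideanSpace.proj (3 : Fin 4) : EuclideanSpace ℝ (Fin 4) →L[ℝ] ℝ))))) := by
    have := ((h3.sub hn).const_mul (1 / 2 : ℝ)).fderiv
    rw [hfu]; exact this
  have hdv : fderiv ℝ vN x = (1 / 2 : ℝ) • (-(EuclideanSpace.proj (3 : Fin 4) : EuclideanSpace ℝ (Fin 4) →L[ℝ] ℝ) -
      ((EuclideanSpace.proj (0 : Fin 4) : EuclideanSpace ℝ (Fin 4) →L[ℝ] ℝ) +
        (θR P₀ (x 3) • (fderiv ℝ M (dropLast 2 x)).comp (dropLast 2) +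
          M (dropLast 2 x) • (deriv (θR P₀) (x 3) •
            (EuclideanSpace.proj (3 : Fin 4) : EuclideanSpace ℝ (Fin 4) →L[ℝ] ℝ))))) := by
    have := ((h3.neg.sub hn).const_mul (1 / 2 : ℝ)).fderiv
    rw [hfv]; exact this
  -- the key: `dũ w = dṽ w = 0` forces `w₃ = 0` and `dN(z)(dl w) = 0`
  have hθ1 : θR P₀ (x 3) = 1 := by rw [hx3]; exact θR_zero
  have hθ'0 : deriv (θR P₀) (x 3) = 0 := deriv_θR_eq_zero hP₀ (by rw [hx3, abs_zero]; exact hP₀)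
  have hkey : ∀ w : EuclideanSpace ℝ (Fin 4), fderiv ℝ uN x w = 0 → fderiv ℝ vN x w = 0 →
      w 3 = 0 ∧ fderiv ℝ N z (dropLast 2 w) = 0 := by
    intro w hu hv
    rw [hdu] at hu
    rw [hdv] at hv
    simp only [smul_apply, sub_apply, add_apply, neg_apply, ContinuousLinearMap.comp_apply, smul_eq_mul,
      hθ1, hθ'0, one_mul, zero_mul, mul_zero] at hu hv
    have e3 : (EuclideanSpace.proj (3 : Fin 4) : EuclideanSpace ℝ (Fin 4) →L[ℝ] ℝ) w = w 3 := rfl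
    have e0 : (EuclideanSpace.proj (0 : Fin 4) : EuclideanSpace ℝ (Fin 4) →L[ℝ] ℝ) w = w 0 := rfl
    rw [e3, e0] at hu hv
    have hw3 : w 3 = 0 := by linarith
    refine ⟨hw3, ?_⟩
    rw [fderiv_M hNs hMdef] at hu
    simp only [sub_apply] at hu
    have e0' : (EuclideanSpace.proj (0 : Fin 3) : EuclideanSpace ℝ (Fin 3) →L[ℝ] ℝ) (dropLast 2 w) = w 0 := by
      show dropLast 2 w 0 = w 0; exact dropLast_two_apply_zero w
    rw [e0'] at hu
    linarith
  -- a coordinate direction `c` with `∂_c N(z) ≠ 0`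
  have hcex : ∃ c : Fin 3, fderiv ℝ N z (EuclideanSpace.single c 1) ≠ 0 := by
    by_contra hall
    apply hdN
    apply clm_eq_zero_of_apply_single_three
    intro i
    by_contra hi
    exact hall ⟨i, hi⟩
  obtain ⟨c, hc⟩ := hcex
  -- `dl w` with two vanishing coordinates is a multiple of the third basis vector
  have hdl : ∀ w : EuclideanSpace ℝ (Fin 4), ∀ c : Fin 3,
      (∀ j : Fin 3, j ≠ c → w (Fin.castSucc j) = 0) →
      dropLast 2 w = w (Fin.castSucc c) • EuclideanSpace.single c (1 : ℝ) := by
    intro w c hw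
    ext j
    rw [dropLast_apply_coord]
    by_cases hj : j = c
    · subst hj; simp
    · simp [hj, hw j hj]
  have hconclude : ∀ w : EuclideanSpace ℝ (Fin 4), fderiv ℝ uN x w = 0 → fderiv ℝ vN x w = 0 →
      (∀ j : Fin 3, j ≠ c → w (Fin.castSucc j) = 0) → w = 0 := by
    intro w hu hv hw
    obtain ⟨hw3, hNw⟩ := hkey w hu hv
    rw [hdl w c hw, map_smul, smul_eq_mul] at hNw
    have hwc : w (Fin.castSucc c) = 0 := (mul_eq_zero.1 hNw).resolve_right hc
    ext i
    by_cases hi : i = 3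
    · subst hi; exact hw3
    · -- `i = castSucc j`
      obtain ⟨j, rfl⟩ : ∃ j : Fin 3, i = Fin.castSucc j := by
        fin_cases i
        · exact ⟨0, rfl⟩
        · exact ⟨1, rfl⟩
        · exact ⟨2, rfl⟩
        · exact absurd rfl hi
      by_cases hjc : j = c
      · subst hjc; exact hwc
      · exact hw j hjc
  -- the three cases for `c`
  fin_cases c
  · refine exists_localDiffeomorph_of_injective huNs hvNs (Fin.castSucc (1 : Fin 3)) (Fin.castSucc (2 : Fin 3))
      fun w hu hv h1 h2 => hconclude w hu hv fun j hj => ?_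
    fin_cases j
    · exact absurd rfl hj
    · exact h1
    · exact h2
  · refine exists_localDiffeomorph_of_injective huNs hvNs (Fin.castSucc (0 : Fin 3)) (Fin.castSucc (2 : Fin 3))
      fun w hu hv h1 h2 => hconclude w hu hv fun j hj => ?_
    fin_cases j
    · exact h1
    · exact absurd rfl hj
    · exact h2
  · refine exists_localDiffeomorph_of_injective huNs hvNs (Fin.castSucc (0 : Fin 3)) (Fin.castSucc (1 : Fin 3))
      fun w hu hv h1 h2 => hconclude w hu hv fun j hj => ?_
    fin_cases j
    · exact h1
    · exact h2
    · exact absurd rfl hj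

end Model

/-! ### Regularity of products at face points -/

/-- If `a x = 0`, `b x ≠ 0` and `da(x) ≠ 0` then `d(-(a b))(x) = -b(x) da(x) ≠ 0`. [folklore] -/
theorem fderiv_neg_mul_ne_zero_of_left {a b : EuclideanSpace ℝ (Fin 4) → ℝ}
    (ha : Differentiable ℝ a) (hb : Differentiable ℝ b) {x : EuclideanSpace ℝ (Fin 4)}
    (ha0 : a x = 0) (hb0 : b x ≠ 0) (hda : fderiv ℝ a x ≠ 0) :
    fderiv ℝ (fun y => -(a y * b y)) x ≠ 0 := by
  have h : HasFDerivAt (fun y => -(a y * b y)) (-(a x • fderiv ℝ b x + b x • fderiv ℝ a x)) x :=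
    ((ha x).hasFDerivAt.mul (hb x).hasFDerivAt).neg
  rw [h.fderiv, ha0, zero_smul, zero_add]
  intro hzero
  apply hda
  have : b x • fderiv ℝ a x = 0 := neg_eq_zero.1 hzero
  exact (smul_eq_zero.1 this).resolve_left hb0

/-- If `b x = 0`, `a x ≠ 0` and `db(x) ≠ 0` then `d(-(a b))(x) = -a(x) db(x) ≠ 0`. [folklore] -/
theorem fderiv_neg_mul_ne_zero_of_right {a b : EuclideanSpace ℝ (Fin 4) → ℝ}
    (ha : Differentiable ℝ a) (hb : Differentiable ℝ b) {x : EuclideanSpace ℝ (Fin 4)}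
    (hb0 : b x = 0) (ha0 : a x ≠ 0) (hdb : fderiv ℝ b x ≠ 0) :
    fderiv ℝ (fun y => -(a y * b y)) x ≠ 0 := by
  have h : HasFDerivAt (fun y => -(a y * b y)) (-(a x • fderiv ℝ b x + b x • fderiv ℝ a x)) x :=
    ((ha x).hasFDerivAt.mul (hb x).hasFDerivAt).neg
  rw [h.fderiv, hb0, zero_smul, add_zero]
  intro hzero
  apply hdb
  have : a x • fderiv ℝ b x = 0 := neg_eq_zero.1 hzero
  exact (smul_eq_zero.1 this).resolve_left ha0

/-! ### The packaged implant -/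

/-- **The implant model** (all that the stabilisation surgery uses of it).  In the coordinates
`x = (n, s, t, p)` of `ℝ⁴` in which the old normal coordinates are `u = (p - n)/2`,
`v = (-p - n)/2` (so that the sector `{u, v ≥ 0}` is `{n ≤ -|p|}` and the central surface is
`{p = n = 0}`), for every point `q⋆` of the stratum `{x₀ = x₃ = 0}` and every radius `R > 0`
there are smooth functions `ũ, ṽ` on `ℝ⁴` and a point `x⋆` such that:
* `ũ - ṽ = p` everywhere, and `(ũ, ṽ) = (u, v)` off a compact subset of the ball `B(q⋆, R)`;
* `∂₃ ũ > 0 > ∂₃ ṽ` everywhere;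
* every point of the new corner locus `{ũ = ṽ = 0}` has a local diffeomorphism of `ℝ⁴` with
  first two coordinates `ũ, ṽ`;
* `x⋆ ∈ B(q⋆, R)` lies in the open quadrant `{ũ, ṽ > 0}` and is the unique critical point there
  of `-ũ ṽ`, nondegenerate of index `1`;
* `-ũ_j ṽ_j = -(ṽ - ũ)(-ũ)` has no critical point in the open wedge `{ṽ - ũ > 0, -ũ > 0}` and
  `-ũ_l ṽ_l = -(-ṽ)(ũ - ṽ)` none in `{-ṽ > 0, ũ - ṽ > 0}`.
Construction: `ũ = u - m`, `ṽ = v - m` with `m = θ_{P₀}(p) · (N(n, s, t) - n)/2`, `N` Milnor's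
recentred birth function (`exists_birth_recentred`) with support radius `r = R/8`, deviation
`ε`, plateau `P₀ = R/4`; this is Gay–Kirby's "eye" added to the trisected Morse `2`-function
`(u, v)` (proof of Lemma 10), one third of the stabilisation.
[cite: GayKirby2016, Def. 8, Lemma 10 and its proof; MilnorHCobordism1965, Lemma 8.2] -/
theorem exists_implant (qs : EuclideanSpace ℝ (Fin 4)) (hqs0 : qs 0 = 0) (hqs3 : qs 3 = 0)
    {R : ℝ} (hR : 0 < R) :
    ∃ (uN vN : EuclideanSpace ℝ (Fin 4) → ℝ) (xs : EuclideanSpace ℝ (Fin 4)),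
      ContDiff ℝ ∞ uN ∧ ContDiff ℝ ∞ vN ∧ (∀ x, uN x - vN x = x 3) ∧
      (∃ Kb : Set (EuclideanSpace ℝ (Fin 4)), IsCompact Kb ∧ Kb ⊆ ball qs R ∧
        ∀ x ∉ Kb, uN x = (x 3 - x 0) / 2 ∧ vN x = (-x 3 - x 0) / 2) ∧
      (∀ x, 0 < fderiv ℝ uN x (EuclideanSpace.single 3 1)) ∧
      (∀ x, fderiv ℝ vN x (EuclideanSpace.single 3 1) < 0) ∧
      (∀ x, uN x = 0 → vN x = 0 →
        ∃ Ψ : OpenPartialHomeomorph (EuclideanSpace ℝ (Fin 4)) (EuclideanSpace ℝ (Fin 4)),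
          x ∈ Ψ.source ∧ ContDiffOn ℝ ∞ Ψ Ψ.source ∧ ContDiffOn ℝ ∞ Ψ.symm Ψ.target ∧
          ∀ y ∈ Ψ.source, Ψ y 0 = uN y ∧ Ψ y 1 = vN y) ∧
      xs ∈ ball qs R ∧ 0 < uN xs ∧ 0 < vN xs ∧
      IsMCriticalPt (𝓡 4) (fun x => -(uN x * vN x)) xs ∧
      (mhessian (𝓡 4) (fun x => -(uN x * vN x)) xs).Nondegenerate ∧
      morseIndex (𝓡 4) (fun x => -(uN x * vN x)) xs = 1 ∧
      (∀ x, 0 < uN x → 0 < vN x → IsMCriticalPt (𝓡 4) (fun x => -(uN x * vN x)) x → x = xs) ∧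
      (∀ x, 0 < vN x - uN x → 0 < -uN x →
        ¬ IsMCriticalPt (𝓡 4) (fun x => -((vN x - uN x) * (-uN x))) x) ∧
      (∀ x, 0 < -vN x → 0 < uN x - vN x →
        ¬ IsMCriticalPt (𝓡 4) (fun x => -((-vN x) * (uN x - vN x))) x) ∧
      -- regularity at the face points of the three wedges
      (∀ x, uN x = 0 → 0 < vN x → ¬ IsMCriticalPt (𝓡 4) (fun x => -(uN x * vN x)) x) ∧
      (∀ x, vN x = 0 → 0 < uN x → ¬ IsMCriticalPt (𝓡 4) (fun x => -(uN x * vN x)) x) ∧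
      (∀ x, vN x - uN x = 0 → 0 < -uN x →
        ¬ IsMCriticalPt (𝓡 4) (fun x => -((vN x - uN x) * (-uN x))) x) ∧
      (∀ x, -uN x = 0 → 0 < vN x - uN x →
        ¬ IsMCriticalPt (𝓡 4) (fun x => -((vN x - uN x) * (-uN x))) x) ∧
      (∀ x, -vN x = 0 → 0 < uN x - vN x →
        ¬ IsMCriticalPt (𝓡 4) (fun x => -((-vN x) * (uN x - vN x))) x) ∧
      (∀ x, uN x - vN x = 0 → 0 < -vN x →
        ¬ IsMCriticalPt (𝓡 4) (fun x => -((-vN x) * (uN x - vN x))) x) := by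
  -- ### parameters
  obtain ⟨C, hC0, hC⟩ := exists_bound_deriv_θ
  set P₀ : ℝ := R / 4 with hP₀def
  have hP₀ : 0 < P₀ := by positivity
  set r : ℝ := R / 8 with hrdef
  have hr : 0 < r := by positivity
  set ε : ℝ := min (R / 16) (R / (8 * (C + 1))) with hεdef
  have hε : 0 < ε := lt_min (by positivity) (by positivity)
  have hε1 : ε ≤ R / 16 := min_le_left _ _
  have hCε : C * ε < R / 8 := by
    have h1 : C * ε ≤ C * (R / (8 * (C + 1))) := mul_le_mul_of_nonneg_left (min_le_right _ _) hC0
    have h2 : C * (R / (8 * (C + 1))) < R / 8 := by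
      rw [mul_div_assoc', div_lt_div_iff₀ (by positivity) (by positivity)]
      nlinarith
    linarith
  have hpar1 : C * ε < P₀ := by rw [hP₀def]; linarith
  have hpar2 : (r + ε) * C * ε < P₀ ^ 2 := by
    have h1 : r + ε ≤ 3 * R / 16 := by rw [hrdef]; linarith
    have h2 : (r + ε) * (C * ε) ≤ 3 * R / 16 * (C * ε) :=
      mul_le_mul_of_nonneg_right h1 (mul_nonneg hC0 hε.le)
    have h3 : 3 * R / 16 * (C * ε) < 3 * R / 16 * (R / 8) := mul_lt_mul_of_pos_left hCε (by positivity)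
    rw [hP₀def]
    nlinarith
  have hpar3 : r + ε + 3 / 2 * C * ε < 2 * P₀ := by rw [hrdef, hP₀def]; nlinarith
  have hrR : r ^ 2 + (3 / 2 * P₀) ^ 2 < R ^ 2 := by rw [hrdef, hP₀def]; nlinarith
  -- ### the birth function and the model functions
  obtain ⟨N, hN, ⟨K, hK, hKball, hNK⟩, hεN, z₀, z₁, -, hcrit, hi₀, -, hNz₀, hNz₁⟩ :=
    exists_birth_recentred (dropLast 2 qs) (by rw [dropLast_two_apply_zero, hqs0]) hr hε
  have hNs : ContDiff ℝ ∞ N := contMDiff_iff_contDiff.1 hN.1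
  set M : EuclideanSpace ℝ (Fin 3) → ℝ := fun z => N z - z 0 with hMdef'
  have hMdef : ∀ z, M z = N z - z 0 := fun z => rfl
  have hMs := contDiff_M hNs hMdef
  set nN : EuclideanSpace ℝ (Fin 4) → ℝ := fun x => x 0 + θR P₀ (x 3) * M (dropLast 2 x) with hnN'
  have hnN : ∀ x, nN x = x 0 + θR P₀ (x 3) * M (dropLast 2 x) := fun x => rfl
  set uN : EuclideanSpace ℝ (Fin 4) → ℝ := fun x => (x 3 - nN x) / 2 with huN'
  have huN : ∀ x, uN x = (x 3 - nN x) / 2 := fun x => rfl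
  set vN : EuclideanSpace ℝ (Fin 4) → ℝ := fun x => (-x 3 - nN x) / 2 with hvN'
  have hvN : ∀ x, vN x = (-x 3 - nN x) / 2 := fun x => rfl
  set q : EuclideanSpace ℝ (Fin 4) → ℝ := fun x => -(uN x * vN x) with hq'
  have hq : ∀ x, q x = (x 3 ^ 2 - nN x ^ 2) / 4 := fun x => by
    show -(uN x * vN x) = _; rw [huN, hvN]; ring
  set xs : EuclideanSpace ℝ (Fin 4) := snocEquiv 3 (z₀, 0) with hxsdef
  have hxs : dropLast 2 xs = z₀ := dropLast_snocEquiv 2 z₀ 0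
  have hxs3 : xs 3 = 0 := snocEquiv_apply_last 3 (z₀, 0)
  obtain ⟨huNs, hvNs⟩ := contDiff_uN_vN hMs hnN huN hvN
  -- ### the critical point
  obtain ⟨huxs, hvxs, hcritxs, -⟩ := crit_xs hNs hMdef hcrit hNz₀ hP₀ hnN huN hvN hq hxs hxs3
  obtain ⟨hnd, hidx⟩ := morseData_q_xs hN hMdef hP₀ hcrit hi₀ hNz₀ hnN hq hxs hxs3
  have hz₀K : z₀ ∈ K := mem_of_isMCriticalPt_of_eq_coord hK.isClosed hNK
    (by rw [← mem_criticalSet (I := 𝓡 3), hcrit]; exact mem_insert _ _)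
  have hxsball : xs ∈ ball qs R := by
    rw [mem_ball, dist_eq_norm]
    have h1 : dist z₀ (dropLast 2 qs) < r := hKball hz₀K
    rw [dist_eq_norm] at h1
    have h2 := norm_sq_eq_dropLast (xs - qs)
    rw [PiLp.sub_apply, hqs3, hxs3, sub_zero, dropLast_sub, hxs] at h2
    have h3 : ‖z₀ - dropLast 2 qs‖ ^ 2 < r ^ 2 := pow_lt_pow_left₀ h1 (norm_nonneg _) two_ne_zero
    have h4 : ‖xs - qs‖ ^ 2 < R ^ 2 := by
      rw [h2]
      have : r ^ 2 ≤ R ^ 2 := by rw [hrdef]; nlinarith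
      nlinarith
    exact lt_of_pow_lt_pow_left₀ 2 hR.le h4
  -- ### the box
  obtain ⟨hKbc, hKbball⟩ := isCompact_box hK hqs3 hKball hrR hR
  refine ⟨uN, vN, xs, huNs, hvNs, fun x => (uN_sub_vN huN hvN x).1,
    ⟨{y | |y 3| ≤ 3 / 2 * P₀ ∧ dropLast 2 y ∈ K}, hKbc, hKbball,
      fun x hx => uN_vN_eq_of_not_mem hMdef hNK hP₀ hnN huN hvN hx⟩,
    fun x => (fderiv_uN_vN_single_three hNs hMdef hεN hP₀ hC hpar1 hnN huN hvN x).1,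
    fun x => (fderiv_uN_vN_single_three hNs hMdef hεN hP₀ hC hpar1 hnN huN hvN x).2,
    fun x hu0 hv0 => exists_adaptedChart hNs hMdef hcrit hNz₀ hNz₁ hP₀ hnN huN hvN hu0 hv0,
    hxsball, huxs, hvxs, (isMCriticalPt_iff_fderiv q xs).2 hcritxs, hnd, hidx,
    fun x hu hv hcx => eq_of_fderiv_q_eq_zero_of_pos hNs hMdef hK.isClosed hKball
      (by rw [dropLast_two_apply_zero, hqs0]) hNK hεN hcrit hNz₁ hP₀ hC hpar2 hnN huN hvN hq hxs hxs3
      hu hv ((isMCriticalPt_iff_fderiv q x).1 hcx),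
    fun x hju hjv hcx => ?_, fun x hlu hlv hcx => ?_, ?_, ?_, ?_, ?_, ?_, ?_⟩
  · -- sector `j`
    have hx3 : x 3 < 0 := by have := (uN_sub_vN huN hvN x).1; linarith
    have hwedge : x 3 < nN x := by
      have h1 : uN x < 0 := by linarith
      rw [huN] at h1; linarith
    have hg : ∀ y, (fun x => -((vN x - uN x) * (-uN x))) y = y 3 * (nN y - y 3) / 2 := fun y => by
      show -((vN y - uN y) * (-uN y)) = _; rw [huN, hvN]; ring
    exact no_crit_j hNs hMdef hK.isClosed hKball (by rw [dropLast_two_apply_zero, hqs0]) hNK hεN hcrit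
      hNz₁ hP₀ hC hpar3 hnN hg hx3 hwedge ((isMCriticalPt_iff_fderiv _ x).1 hcx)
  · -- sector `l`
    have hx3 : 0 < x 3 := by have := (uN_sub_vN huN hvN x).1; linarith
    have hwedge : 0 < x 3 + nN x := by
      rw [hvN] at hlu; linarith
    have hg : ∀ y, (fun x => -((-vN x) * (uN x - vN x))) y = -(y 3 * (y 3 + nN y)) / 2 := fun y => by
      show -((-vN y) * (uN y - vN y)) = _; rw [huN, hvN]; ring
    exact no_crit_l hNs hMdef hK.isClosed hKball (by rw [dropLast_two_apply_zero, hqs0]) hNK hεN hcrit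
      hNz₁ hP₀ hC hpar3 hnN hg hx3 hwedge ((isMCriticalPt_iff_fderiv _ x).1 hcx)
  -- ### regularity at face points
  · intro x ha0 hb0 hcx
    have hreg := (fderiv_uN_vN_single_three hNs hMdef hεN hP₀ hC hpar1 hnN huN hvN x).1
    exact fderiv_neg_mul_ne_zero_of_left (huNs.differentiable (by simp)) (hvNs.differentiable (by simp))
      ha0 hb0.ne' (fun h0 => by rw [h0] at hreg; simp at hreg) ((isMCriticalPt_iff_fderiv _ x).1 hcx)
  · intro x hb0 ha0 hcx
    have hreg := (fderiv_uN_vN_single_three hNs hMdef hεN hP₀ hC hpar1 hnN huN hvN x).2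
    exact fderiv_neg_mul_ne_zero_of_right (huNs.differentiable (by simp)) (hvNs.differentiable (by simp))
      hb0 ha0.ne' (fun h0 => by rw [h0] at hreg; simp at hreg) ((isMCriticalPt_iff_fderiv _ x).1 hcx)
  · intro x ha0 hb0 hcx
    have hdiff : fderiv ℝ (fun y => vN y - uN y) x ≠ 0 := by
      have hfun : (fun y => vN y - uN y) = fun y : EuclideanSpace ℝ (Fin 4) => -y 3 := by
        funext y; have := (uN_sub_vN huN hvN y).1; linarith
      rw [hfun]
      have hd : HasFDerivAt (fun y : EuclideanSpace ℝ (Fin 4) => -y 3)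
          (-(EuclideanSpace.proj (3 : Fin 4) : EuclideanSpace ℝ (Fin 4) →L[ℝ] ℝ)) x :=
        (EuclideanSpace.proj (3 : Fin 4) : EuclideanSpace ℝ (Fin 4) →L[ℝ] ℝ).hasFDerivAt.neg
      rw [hd.fderiv]
      intro h0
      have := congrArg (fun L : EuclideanSpace ℝ (Fin 4) →L[ℝ] ℝ => L (EuclideanSpace.single 3 1)) h0
      simp at this
    exact fderiv_neg_mul_ne_zero_of_left ((hvNs.sub huNs).differentiable (by simp))
      (huNs.neg.differentiable (by simp)) ha0 hb0.ne' hdiff ((isMCriticalPt_iff_fderiv _ x).1 hcx)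
  · intro x hb0 ha0 hcx
    have hreg := (fderiv_uN_vN_single_three hNs hMdef hεN hP₀ hC hpar1 hnN huN hvN x).1
    have hdiff : fderiv ℝ (fun y => -uN y) x ≠ 0 := by
      have hd : HasFDerivAt (fun y => -uN y) (-fderiv ℝ uN x) x :=
        ((huNs.differentiable (by simp)) x).hasFDerivAt.neg
      rw [hd.fderiv]
      intro h0
      have : fderiv ℝ uN x = 0 := neg_eq_zero.1 h0
      rw [this] at hreg; simp at hreg
    exact fderiv_neg_mul_ne_zero_of_right ((hvNs.sub huNs).differentiable (by simp))
      (huNs.neg.differentiable (by simp)) hb0 ha0.ne' hdiff ((isMCriticalPt_iff_fderiv _ x).1 hcx)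
  · intro x ha0 hb0 hcx
    have hreg := (fderiv_uN_vN_single_three hNs hMdef hεN hP₀ hC hpar1 hnN huN hvN x).2
    have hdiff : fderiv ℝ (fun y => -vN y) x ≠ 0 := by
      have hd : HasFDerivAt (fun y => -vN y) (-fderiv ℝ vN x) x :=
        ((hvNs.differentiable (by simp)) x).hasFDerivAt.neg
      rw [hd.fderiv]
      intro h0
      have : fderiv ℝ vN x = 0 := neg_eq_zero.1 h0
      rw [this] at hreg; simp at hreg
    exact fderiv_neg_mul_ne_zero_of_left (hvNs.neg.differentiable (by simp))
      ((huNs.sub hvNs).differentiable (by simp)) ha0 hb0.ne' hdiff ((isMCriticalPt_iff_fderiv _ x).1 hcx)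
  · intro x hb0 ha0 hcx
    have hdiff : fderiv ℝ (fun y => uN y - vN y) x ≠ 0 := by
      have hfun : (fun y => uN y - vN y) = fun y : EuclideanSpace ℝ (Fin 4) => y 3 := by
        funext y; exact (uN_sub_vN huN hvN y).1
      rw [hfun]
      have hd : HasFDerivAt (fun y : EuclideanSpace ℝ (Fin 4) => y 3)
          (EuclideanSpace.proj (3 : Fin 4) : EuclideanSpace ℝ (Fin 4) →L[ℝ] ℝ) x :=
        (EuclideanSpace.proj (3 : Fin 4) : EuclideanSpace ℝ (Fin 4) →L[ℝ] ℝ).hasFDerivAt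
      rw [hd.fderiv]
      intro h0
      have := congrArg (fun L : EuclideanSpace ℝ (Fin 4) →L[ℝ] ℝ => L (EuclideanSpace.single 3 1)) h0
      simp at this
    exact fderiv_neg_mul_ne_zero_of_right (hvNs.neg.differentiable (by simp))
      ((huNs.sub hvNs).differentiable (by simp)) hb0 ha0.ne' hdiff ((isMCriticalPt_iff_fderiv _ x).1 hcx)

end Implant

end Literature.Topology.FourManifolds
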